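import Literature.MathematicalPhysics.QuantumFieldTheory.DurhuusFrohlichSlabCriterion
import Literature.MathematicalPhysics.QuantumFieldTheory.WilsonEnergyConvexity
import Literature.MathematicalPhysics.QuantumFieldTheory.TorusLoopReflection
import HarnessLib

/-!
# Proof of the Durhuus–Fröhlich slab criterion for Wilson's area law
# (`durhuusFrohlich_areaLaw_of_slabClustering_holds`)

This file DISCHARGES the named fact `durhuusFrohlich_areaLaw_of_slabClustering d N` of
`DurhuusFrohlichSlabCriterion.lean` (Cao–Nissim–Sheffield, arXiv:2509.04688v2, Theorem 2.3 =
Durhuus–Fröhlich, CMP 75 (1980) 103–151, Thms. 1.2–1.3, case `G = SU(N)`, `N ≥ 2`): if the slab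
`σ`-models `μ_{A,B}` (CNS Def. 2.1, `slabMeasure N β A B`) have exponentially decaying covariances of
single-site matrix entries, uniformly in the slab size and in the boundary fields `A, B`, then the
`SU(N)` Wilson theory at tree coupling `Nβ` satisfies `|⟨W_{R×T}⟩_{Λ_L,Nβ}| ≤ C₁' e^{-C₂' RT}` for all
rectangular loops with `2R, 2T ≤ L`, with `C₁', C₂' > 0` depending only on `(N, d, β)`.

## The printed proof and how it is followed

CNS §2 (proof of Thm. 2.3, p. 4): (P1) condition on all links orthogonal to the length-`T` side;
the conditional law of the vertical links of each height-1 slab is the slab `σ`-model with boundary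
fields the horizontal links above and below, and the loop expectation becomes a product over the
`T` slabs of slab two-point functions `E_{A,B}[(Q_x)_{ij}(Q_y⁻¹)_{kl}]`, `d(x,y) = R`; (P2) for the
central element `zI ∈ G`, `z ≠ 1`, `E_{A,B}[(Q_x)_{ij}] = z E_{A,B}[(Q_x)_{ij}] = 0`, so the two-point
function is a covariance, bounded by `C₁e^{-C₂R}` uniformly in `A, B`; (P3) hence
`|⟨tr Q_ℓ⟩| ≤ C₁ N^{|ℓ|} e^{-C₂·area}`; (P4) absorb the perimeter factor using the perimeter law.

* §Geometry/§Splitting (P1): for a vertical direction `v` and a height `t`, the sites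
  `ins v t x̄` over the slice `(ℤ/L)^n` (`d = n+1`), the vertical links `IsSlab v t` of the slab
  `{x_v = t}`, and the measurable, measure-preserving splitting
  `splitEquiv v t : GaugeConfig (n+1) L G ≃ᵐ (Site n L → G) × (rest → G)` of product Haar measure.
* §Action (P1): `exp(-Nβ S(glue Q r)) = exp(-Nβ S_rest(r)) e^{-Nβ N |E(Λ^n)|} exp(S_{A(r),B(r)}(Q))`
  (`exp_neg_wilsonAction_glue`) with `A` = links at height `t+1`, `B` = links at height `t`,
  `Q_x̄ = U(ins v t x̄, v)` — i.e. the conditional law of the slab IS `slabMeasure N β A B`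
  (CNS Def. 2.1 verbatim; for plaquettes oriented `(k, v)` with `k < v` one uses `Re tr M* = Re tr M`).
* §Peel/§SlabAvg (P1): the slab disintegration `integral_weight_mul_eq` (Fubini over the splitting,
  `integral_tilted`) and its corollary `integral_weight_mul_mul_eq_slabAvg`: a factor living on the
  slab may be replaced by its slab expectation when the cofactor does not see the slab.
* §Centre/§TwoPoint (P2): `slabMeasure` is invariant under `Q ↦ (e^{2πi/N} I) Q` (Haar left
  invariance + invariance of `S_{A,B}`), so `E[(Q_x)_{ij}] = 0 = E[(Q_y⁻¹)_{kl}]`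
  (`integral_entry_eq_zero`), and the complex two-point function is the sum of four real covariances:
  `‖E[(Q_x)_{ab}(Q_y⁻¹)_{cd}]‖ ≤ 4C₁e^{-C₂ d(x,y)}` (`norm_integral_entry_mul_inv_entry_le`).
* §Induction (P3, sharpened): peeling the top slab `T` times, keeping the horizontal parts of the
  loop as unitary MATRICES (entries `≤ 1`) instead of expanding them in `N^{|ℓ|}` terms:
  `|∫ e^{-NβS} tr(A·leg_T·B·leg_T^*)| ≤ N²K(N²ε)^T ∫e^{-NβS}` (`norm_integral_loopObs_le`), whence
  `|⟨W_{R×T}⟩| ≤ N (4N²C₁e^{-C₂R})^T` (`abs_wilsonExpectation_le_pow`).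
* §Assembly (P4, DEVIATION from print — a strictly shorter road): instead of the perimeter-law
  input of CNS (Chatterjee 2021, not in this file's cone), the same bound with the two directions
  of the rectangle exchanged (`wilsonLoop_swap`: `W(x,j,i,T,R) = W(x,i,j,R,T)` pointwise, the loop
  traversed backwards) and `|⟨W⟩| ≤ 1`: if `max(R,T) ≥ M₀ = 2 log(max(4N²C₁,1))/C₂` the oriented
  bound gives `N e^{-(C₂/2)RT}`, otherwise `RT < M₀²` and `1 ≤ e^{(C₂/2)M₀²} e^{-(C₂/2)RT}`.
  So `C₂' = C₂/2`, `C₁' = max(N, e^{(C₂/2)M₀²})`.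

No new definitions of mathematical content beyond proof-internal bookkeeping (`ins`, `glue`,
`slabPlaq`, `leg`, `loopObs`, …); no new named facts.

## References

* S. Cao, R. Nissim, S. Sheffield, *Dynamical approach to area law for lattice Yang–Mills*,
  arXiv:2509.04688v2, §2: Definition 2.1, Theorem 2.3 and its proof (p. 4) [CaoNissimSheffield2025dynamical].
* B. Durhuus, J. Fröhlich, *A connection between ν-dimensional Yang–Mills theory and
  (ν−1)-dimensional, non-linear σ-models*, Comm. Math. Phys. 75 (1980) 103–151, Thms. 1.2–1.3
  (cite-only; followed through the CNS restatement).
-/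

noncomputable section

open MeasureTheory
open Literature.MathematicalPhysics.QuantumLattice (fundamentalRep continuous_fundamentalRep fundamentalRep_apply)

namespace Literature.MathematicalPhysics.QuantumFieldTheory

namespace DurhuusFrohlich

variable {n L : ℕ}

/-! ### Slab geometry: the site with `v`-coordinate `t` over a slice site -/

/-- The site of `(ℤ/L)^{n+1}` whose `v`-coordinate is `t` and whose other coordinates are `x`. [folklore] -/
def ins (v : Fin (n + 1)) (t : ZMod L) (x : Site n L) : Site (n + 1) L := Fin.insertNth v t x

/-- The slice site obtained by deleting the `v`-coordinate. [folklore] -/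
def rem (v : Fin (n + 1)) (y : Site (n + 1) L) : Site n L := fun k => y (v.succAbove k)

/-- The `v`-coordinate of `ins v t x` is `t`. [folklore] -/
@[simp] private theorem ins_apply_same (v : Fin (n + 1)) (t : ZMod L) (x : Site n L) : ins v t x v = t := by
  simp [ins]

/-- The other coordinates of `ins v t x` are those of `x`. [folklore] -/
@[simp] private theorem ins_apply_succAbove (v : Fin (n + 1)) (t : ZMod L) (x : Site n L) (k : Fin n) :
    ins v t x (v.succAbove k) = x k := by
  simp [ins]

/-- `rem v` is a left inverse of `ins v t`. [folklore] -/
@[simp] private theorem rem_ins (v : Fin (n + 1)) (t : ZMod L) (x : Site n L) : rem v (ins v t x) = x := by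
  funext k; simp [rem]

/-- `ins v (y v) (rem v y) = y`. [folklore] -/
private theorem ins_rem (v : Fin (n + 1)) (y : Site (n + 1) L) : ins v (y v) (rem v y) = y := by
  funext j
  rcases Fin.eq_self_or_eq_succAbove v j with rfl | ⟨k, rfl⟩
  · simp
  · simp [rem]

/-- `ins v t` is injective. [folklore] -/
private theorem ins_injective (v : Fin (n + 1)) (t : ZMod L) : Function.Injective (ins (L := L) v t) := by
  intro x y h
  have := congrArg (rem v) h
  simpa using this

/-- Moving up one slab: `ins v t x + e_v = ins v (t+1) x`. [folklore] -/
private theorem ins_shift_self (v : Fin (n + 1)) (t : ZMod L) (x : Site n L) :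
    (ins v t x).shift v = ins v (t + 1) x := by
  funext j
  rcases Fin.eq_self_or_eq_succAbove v j with rfl | ⟨k, rfl⟩
  · simp [Site.shift]
  · simp [Site.shift, Fin.succAbove_ne]

/-- Moving inside the slab: `ins v t x + e_{succAbove v k} = ins v t (x + e_k)`. [folklore] -/
private theorem ins_shift_succAbove (v : Fin (n + 1)) (t : ZMod L) (x : Site n L) (k : Fin n) :
    (ins v t x).shift (v.succAbove k) = ins v t (x.shift k) := by
  funext j
  rcases Fin.eq_self_or_eq_succAbove v j with rfl | ⟨k', rfl⟩
  · simp [Site.shift, Fin.ne_succAbove]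
  · by_cases hk : k' = k
    · subst hk; simp [Site.shift]
    · have hne : v.succAbove k' ≠ v.succAbove k := fun h => hk (Fin.succAbove_right_injective h)
      simp [Site.shift, hk, hne]

/-- Iterated vertical shift: `ins v t x + s e_v = ins v (t + s) x`. [folklore] -/
private theorem ins_add_single (v : Fin (n + 1)) (t : ZMod L) (x : Site n L) (s : ZMod L) :
    ins v t x + Pi.single v s = ins v (t + s) x := by
  funext j
  rcases Fin.eq_self_or_eq_succAbove v j with rfl | ⟨k, rfl⟩
  · simp
  · simp [Fin.succAbove_ne]

/-- Horizontal displacement inside the slab: `ins v t x + s e_{succAbove v k} = ins v t (x + s e_k)`. [folklore] -/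
private theorem ins_add_single_succAbove (v : Fin (n + 1)) (t : ZMod L) (x : Site n L) (k : Fin n)
    (s : ZMod L) : ins v t x + Pi.single (v.succAbove k) s = ins v t (x + Pi.single k s) := by
  funext j
  rcases Fin.eq_self_or_eq_succAbove v j with rfl | ⟨k', rfl⟩
  · simp [Fin.ne_succAbove]
  · by_cases hk : k' = k
    · subst hk; simp
    · have hne : v.succAbove k' ≠ v.succAbove k := fun h => hk (Fin.succAbove_right_injective h)
      simp [hk, hne]

/-! ### Vertical edges of one slab and the splitting of configurations -/

/-- The edge `e` is a VERTICAL edge of the slab `{x_v = t}`: direction `v`, base point at height `t`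
(CNS §2: «the “vertical” edges going between the two horizontal planes» `{x_v = t}`, `{x_v = t+1}`). [cite: CaoNissimSheffield2025dynamical, §2] -/
def IsSlab (v : Fin (n + 1)) (t : ZMod L) (e : Edge (n + 1) L) : Prop := e.2 = v ∧ e.1 v = t

/-- Instance (plumbing). [folklore] -/
instance (v : Fin (n + 1)) (t : ZMod L) : DecidablePred (IsSlab (L := L) v t) := fun e => by
  unfold IsSlab; infer_instance

/-- The edge `(ins v t x, v)` is a vertical edge of the slab `{x_v = t}`. [folklore] -/
private theorem isSlab_ins (v : Fin (n + 1)) (t : ZMod L) (x : Site n L) : IsSlab v t (ins v t x, v) :=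
  ⟨rfl, ins_apply_same v t x⟩

/-- The vertical edges of the slab `{x_v = t}` are in bijection with the slice sites. [folklore] -/
def slabEquiv (v : Fin (n + 1)) (t : ZMod L) : Site n L ≃ {e : Edge (n + 1) L // IsSlab v t e} where
  toFun x := ⟨(ins v t x, v), isSlab_ins v t x⟩
  invFun e := rem v e.1.1
  left_inv x := rem_ins v t x
  right_inv e := by
    obtain ⟨⟨y, w⟩, hw, hy⟩ := e
    simp only at hw hy
    subst hw
    subst hy
    simp [ins_rem]

variable {G : Type*}

/-- Glue a slab configuration `Q` (vertical links of the slab `{x_v = t}`) and a configuration `r`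
of all remaining links into a torus gauge configuration. [folklore] -/
def glue (v : Fin (n + 1)) (t : ZMod L) (Q : Site n L → G)
    (r : {e : Edge (n + 1) L // ¬ IsSlab v t e} → G) : GaugeConfig (n + 1) L G :=
  fun e => if h : IsSlab v t e then Q (rem v e.1) else r ⟨e, h⟩

/-- The vertical links of the slab `{x_v = t}`, as a slab spin configuration. [folklore] -/
def slabPart (v : Fin (n + 1)) (t : ZMod L) (U : GaugeConfig (n + 1) L G) : Site n L → G :=
  fun x => U (ins v t x, v)

/-- All links other than the vertical links of the slab `{x_v = t}`. [folklore] -/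
def restPart (v : Fin (n + 1)) (t : ZMod L) (U : GaugeConfig (n + 1) L G) :
    {e : Edge (n + 1) L // ¬ IsSlab v t e} → G :=
  fun e => U e.1

/-- Gluing, evaluated on a vertical slab edge. [folklore] -/
@[simp] private theorem glue_ins (v : Fin (n + 1)) (t : ZMod L) (Q : Site n L → G)
    (r : {e : Edge (n + 1) L // ¬ IsSlab v t e} → G) (x : Site n L) :
    glue v t Q r (ins v t x, v) = Q x := by
  simp [glue, isSlab_ins]

/-- Gluing, evaluated on a slab edge. [folklore] -/
private theorem glue_of_isSlab (v : Fin (n + 1)) (t : ZMod L) (Q : Site n L → G)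
    (r : {e : Edge (n + 1) L // ¬ IsSlab v t e} → G) {e : Edge (n + 1) L} (h : IsSlab v t e) :
    glue v t Q r e = Q (rem v e.1) := by
  simp [glue, h]

/-- Gluing, evaluated off the slab. [folklore] -/
private theorem glue_of_not_isSlab (v : Fin (n + 1)) (t : ZMod L) (Q : Site n L → G)
    (r : {e : Edge (n + 1) L // ¬ IsSlab v t e} → G) {e : Edge (n + 1) L} (h : ¬ IsSlab v t e) :
    glue v t Q r e = r ⟨e, h⟩ := by
  simp [glue, h]

/-- The slab part of a glued configuration. [folklore] -/
@[simp] private theorem slabPart_glue (v : Fin (n + 1)) (t : ZMod L) (Q : Site n L → G)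
    (r : {e : Edge (n + 1) L // ¬ IsSlab v t e} → G) : slabPart v t (glue v t Q r) = Q := by
  funext x; simp [slabPart]

/-- The rest part of a glued configuration. [folklore] -/
@[simp] private theorem restPart_glue (v : Fin (n + 1)) (t : ZMod L) (Q : Site n L → G)
    (r : {e : Edge (n + 1) L // ¬ IsSlab v t e} → G) : restPart v t (glue v t Q r) = r := by
  funext e; simp [restPart, glue_of_not_isSlab v t Q r e.2]

/-- Gluing the two parts of a configuration gives it back. [folklore] -/
@[simp] private theorem glue_slabPart_restPart (v : Fin (n + 1)) (t : ZMod L) (U : GaugeConfig (n + 1) L G) :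
    glue v t (slabPart v t U) (restPart v t U) = U := by
  funext e
  by_cases h : IsSlab v t e
  · rw [glue_of_isSlab v t _ _ h]
    obtain ⟨y, w⟩ := e
    obtain ⟨hw, hy⟩ := h
    simp only at hw hy
    subst hw; subst hy
    simp [slabPart, ins_rem]
  · rw [glue_of_not_isSlab v t _ _ h]; rfl

/-- Two configurations with the same rest part differ only on the slab. [folklore] -/
private theorem glue_slabPart_eq_of_restPart_eq (v : Fin (n + 1)) (t : ZMod L) {U : GaugeConfig (n + 1) L G}
    (Q : Site n L → G) {e : Edge (n + 1) L} (h : ¬ IsSlab v t e) :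
    glue v t Q (restPart v t U) e = U e := by
  rw [glue_of_not_isSlab v t _ _ h]; rfl

section Measure

variable [MeasurableSpace G]

/-- Gluing is measurable in the pair (slab configuration, rest). [folklore] -/
private theorem measurable_glue (v : Fin (n + 1)) (t : ZMod L) :
    Measurable fun p : (Site n L → G) × ({e : Edge (n + 1) L // ¬ IsSlab v t e} → G) =>
      glue v t p.1 p.2 := by
  refine measurable_pi_lambda _ fun e => ?_
  by_cases h : IsSlab v t e
  · have : (fun p : (Site n L → G) × ({e : Edge (n + 1) L // ¬ IsSlab v t e} → G) =>
        glue v t p.1 p.2 e) = fun p => p.1 (rem v e.1) := by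
      funext p; exact glue_of_isSlab v t _ _ h
    rw [this]
    exact (measurable_pi_apply _).comp measurable_fst
  · have : (fun p : (Site n L → G) × ({e : Edge (n + 1) L // ¬ IsSlab v t e} → G) =>
        glue v t p.1 p.2 e) = fun p => p.2 ⟨e, h⟩ := by
      funext p; exact glue_of_not_isSlab v t _ _ h
    rw [this]
    exact (measurable_pi_apply _).comp measurable_snd

/-- The splitting `U ↦ (vertical links of the slab, the rest)` as a measurable equivalence. [folklore] -/
def splitEquiv (v : Fin (n + 1)) (t : ZMod L) :
    GaugeConfig (n + 1) L G ≃ᵐ (Site n L → G) × ({e : Edge (n + 1) L // ¬ IsSlab v t e} → G) where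
  toFun U := (slabPart v t U, restPart v t U)
  invFun p := glue v t p.1 p.2
  left_inv U := glue_slabPart_restPart v t U
  right_inv p := by obtain ⟨Q, r⟩ := p; simp
  measurable_toFun := by
    refine Measurable.prodMk ?_ ?_
    · exact measurable_pi_lambda _ fun x => measurable_pi_apply _
    · exact measurable_pi_lambda _ fun e => measurable_pi_apply _
  measurable_invFun := measurable_glue v t

/-- The splitting map, evaluated. [folklore] -/
@[simp] private theorem splitEquiv_apply (v : Fin (n + 1)) (t : ZMod L) (U : GaugeConfig (n + 1) L G) :
    splitEquiv v t U = (slabPart v t U, restPart v t U) := rfl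

/-- The inverse of the splitting map is gluing. [folklore] -/
@[simp] private theorem splitEquiv_symm_apply (v : Fin (n + 1)) (t : ZMod L)
    (p : (Site n L → G) × ({e : Edge (n + 1) L // ¬ IsSlab v t e} → G)) :
    (splitEquiv (G := G) v t).symm p = glue v t p.1 p.2 := rfl

variable [NeZero L]

/-- The splitting map carries the product measure `μ^{⊗E}` to `μ^{⊗Λ^n} ⊗ μ^{⊗E'}` (the product
structure behind CNS's «conditioning on the horizontal links»). [cite: CaoNissimSheffield2025dynamical, §2] -/
theorem measurePreserving_splitEquiv (v : Fin (n + 1)) (t : ZMod L) (μ : Measure G)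
    [IsProbabilityMeasure μ] :
    MeasurePreserving (splitEquiv (G := G) v t) (Measure.pi fun _ : Edge (n + 1) L => μ)
      ((Measure.pi fun _ : Site n L => μ).prod
        (Measure.pi fun _ : {e : Edge (n + 1) L // ¬ IsSlab v t e} => μ)) := by
  classical
  have h1 := measurePreserving_piEquivPiSubtypeProd (fun _ : Edge (n + 1) L => μ) (IsSlab v t)
  have h2 := (measurePreserving_piCongrLeft (fun _ : {e : Edge (n + 1) L // IsSlab v t e} => μ)
    (slabEquiv v t)).symm _
  have h3 := h2.prod (MeasurePreserving.id
    (Measure.pi fun _ : {e : Edge (n + 1) L // ¬ IsSlab v t e} => μ))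
  have h4 := h3.comp h1
  have hfun : (Prod.map (⇑(MeasurableEquiv.piCongrLeft (fun _ => G) (slabEquiv v t)).symm) id ∘
      ⇑(MeasurableEquiv.piEquivPiSubtypeProd (fun _ => G) (IsSlab v t))) = ⇑(splitEquiv (G := G) v t) := by
    funext U
    rfl
  rw [hfun] at h4
  exact h4

end Measure


/-! ### The slab decomposition of the Wilson action (`G = SU(N)`) -/

section Action

variable {N : ℕ}

/-- `SU(N)` as a type. [folklore] -/
abbrev SU (N : ℕ) : Type := Matrix.specialUnitaryGroup (Fin N) ℂ

/-- `U(N)` as a type. [folklore] -/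
abbrev UN (N : ℕ) : Type := Matrix.unitaryGroup (Fin N) ℂ

/-- An `SU(N)` matrix as a `U(N)` matrix. [folklore] -/
def toU (g : SU N) : UN N := ⟨g.1, g.2.1⟩

/-- Coercion of `toU g`. [folklore] -/
@[simp] private theorem coe_toU (g : SU N) : ((toU g : UN N) : Matrix (Fin N) (Fin N) ℂ) = g := rfl

/-- Coercion of `(toU g)⁻¹` is the adjoint matrix. [folklore] -/
@[simp] private theorem coe_toU_inv (g : SU N) :
    (((toU g)⁻¹ : UN N) : Matrix (Fin N) (Fin N) ℂ) = star (g : Matrix (Fin N) (Fin N) ℂ) := rfl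

/-- Coercion of `g⁻¹` in `SU(N)` is the adjoint matrix. [folklore] -/
private theorem coe_inv_SU (g : SU N) : ((g⁻¹ : SU N) : Matrix (Fin N) (Fin N) ℂ) =
    star (g : Matrix (Fin N) (Fin N) ℂ) := rfl

/-- The TOP boundary field of the slab `{x_v = t}`: the horizontal links at height `t + 1`,
indexed by the slice edges (`A` of Cao–Nissim–Sheffield Def. 2.1). [cite: CaoNissimSheffield2025dynamical, Definition 2.1] -/
def topField (v : Fin (n + 1)) (t : ZMod L) (U : GaugeConfig (n + 1) L (SU N)) : Edge n L → UN N :=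
  fun e => toU (U (ins v (t + 1) e.1, v.succAbove e.2))

/-- The BOTTOM boundary field of the slab `{x_v = t}`: the horizontal links at height `t`
(`B` of Cao–Nissim–Sheffield Def. 2.1). [cite: CaoNissimSheffield2025dynamical, Definition 2.1] -/
def botField (v : Fin (n + 1)) (t : ZMod L) (U : GaugeConfig (n + 1) L (SU N)) : Edge n L → UN N :=
  fun e => toU (U (ins v t e.1, v.succAbove e.2))

/-- Top boundary edges are not vertical slab edges. [folklore] -/
private theorem not_isSlab_top (v : Fin (n + 1)) (t : ZMod L) (e : Edge n L) :
    ¬ IsSlab v t (ins v (t + 1) e.1, v.succAbove e.2) := fun h => Fin.succAbove_ne v e.2 h.1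

/-- Bottom boundary edges are not vertical slab edges. [folklore] -/
private theorem not_isSlab_bot (v : Fin (n + 1)) (t : ZMod L) (e : Edge n L) :
    ¬ IsSlab v t (ins v t e.1, v.succAbove e.2) := fun h => Fin.succAbove_ne v e.2 h.1

/-- The top boundary field does not see the slab. [folklore] -/
@[simp] private theorem topField_glue (v : Fin (n + 1)) (t : ZMod L) (Q : Site n L → SU N)
    (r : {e : Edge (n + 1) L // ¬ IsSlab v t e} → SU N) :
    topField v t (glue v t Q r) = topField v t (glue v t (fun _ => 1) r) := by
  funext e
  simp only [topField, glue_of_not_isSlab v t _ _ (not_isSlab_top v t e)]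

/-- The bottom boundary field does not see the slab. [folklore] -/
@[simp] private theorem botField_glue (v : Fin (n + 1)) (t : ZMod L) (Q : Site n L → SU N)
    (r : {e : Edge (n + 1) L // ¬ IsSlab v t e} → SU N) :
    botField v t (glue v t Q r) = botField v t (glue v t (fun _ => 1) r) := by
  funext e
  simp only [botField, glue_of_not_isSlab v t _ _ (not_isSlab_bot v t e)]

variable [NeZero L]

/-- One plaquette term `N - Re tr U_p` of the `SU(N)` Wilson action. [folklore] -/
def plaqTerm (U : GaugeConfig (n + 1) L (SU N)) (p : Plaquette (n + 1) L) : ℝ :=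
  (N : ℝ) - ((plaquetteHolonomy U p.1 p.2.1.1 p.2.1.2 : SU N) : Matrix (Fin N) (Fin N) ℂ).trace.re

/-- The `SU(N)` Wilson action as a sum of plaquette terms. [folklore] -/
private theorem wilsonAction_eq_sum_plaqTerm (U : GaugeConfig (n + 1) L (SU N)) :
    wilsonAction (fundamentalRep (Fin N)) U = ∑ p, plaqTerm U p := by
  simp [wilsonAction, plaqTerm]

omit [NeZero L] in
/-- A plaquette term depends only on the four links of the plaquette. [folklore] -/
private theorem plaqTerm_congr {U U' : GaugeConfig (n + 1) L (SU N)} {p : Plaquette (n + 1) L}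
    (h₁ : U (p.1, p.2.1.1) = U' (p.1, p.2.1.1)) (h₂ : U (p.1.shift p.2.1.1, p.2.1.2) = U' (p.1.shift p.2.1.1, p.2.1.2))
    (h₃ : U (p.1.shift p.2.1.2, p.2.1.1) = U' (p.1.shift p.2.1.2, p.2.1.1)) (h₄ : U (p.1, p.2.1.2) = U' (p.1, p.2.1.2)) :
    plaqTerm U p = plaqTerm U' p := by
  simp only [plaqTerm, plaquetteHolonomy, h₁, h₂, h₃, h₄]

/-- The slab term of one slice edge: `Re Tr(Q_x A_e Q_{x+e_k}⁻¹ B_e⁻¹)`. [cite: CaoNissimSheffield2025dynamical, Definition 2.1] -/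
def edgeTerm (v : Fin (n + 1)) (t : ZMod L) (U : GaugeConfig (n + 1) L (SU N)) (e : Edge n L) : ℝ :=
  (((slabPart v t U e.1 : SU N) : Matrix (Fin N) (Fin N) ℂ) * (topField v t U e : Matrix (Fin N) (Fin N) ℂ) *
    ((slabPart v t U (e.1.shift e.2))⁻¹ : SU N) * ((botField v t U e)⁻¹ : UN N)).trace.re

/-- The slab action as a sum of edge terms. [folklore] -/
private theorem slabAction_eq_sum_edgeTerm (v : Fin (n + 1)) (t : ZMod L) (β : ℝ) (U : GaugeConfig (n + 1) L (SU N)) :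
    slabAction N β (topField v t U) (botField v t U) (slabPart v t U) =
      (N : ℝ) * β * ∑ e, edgeTerm v t U e := by
  unfold slabAction edgeTerm
  rfl

/-- The ordered pair of directions `{v, k}` (`k ≠ v`) as a plaquette orientation. [folklore] -/
def slabDirs (v k : Fin (n + 1)) (h : k ≠ v) : {p : Fin (n + 1) × Fin (n + 1) // p.1 < p.2} :=
  if hlt : v < k then ⟨(v, k), hlt⟩ else ⟨(k, v), lt_of_le_of_ne (not_lt.1 hlt) h⟩

/-- The underlying ordered pair of `slabDirs`. [folklore] -/
private theorem slabDirs_val (v k : Fin (n + 1)) (h : k ≠ v) :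
    (slabDirs v k h).1 = if v < k then (v, k) else (k, v) := by
  unfold slabDirs; split_ifs <;> rfl

/-- `slabDirs v k` determines `k`. [folklore] -/
private theorem eq_of_slabDirs_eq {v k₁ k₂ : Fin (n + 1)} {h₁ : k₁ ≠ v} {h₂ : k₂ ≠ v}
    (h : slabDirs v k₁ h₁ = slabDirs v k₂ h₂) : k₁ = k₂ := by
  have h' := congrArg Subtype.val h
  rw [slabDirs_val, slabDirs_val] at h'
  split_ifs at h' with ha hb hb
  · exact (Prod.ext_iff.1 h').2
  · exact absurd (Prod.ext_iff.1 h').1.symm h₂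
  · exact absurd (Prod.ext_iff.1 h').1 h₁
  · exact (Prod.ext_iff.1 h').1

/-- The plaquette of the slab `{x_v = t}` standing on the slice edge `e = (x, k)`: based at `ins v t x`,
in the plane `{v, succAbove v k}`. [folklore] -/
def slabPlaq (v : Fin (n + 1)) (t : ZMod L) (e : Edge n L) : Plaquette (n + 1) L :=
  (ins v t e.1, slabDirs v (v.succAbove e.2) (Fin.succAbove_ne v e.2))

omit [NeZero L] in
/-- Distinct slice edges carry distinct slab plaquettes. [folklore] -/
private theorem slabPlaq_injective (v : Fin (n + 1)) (t : ZMod L) :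
    Function.Injective (slabPlaq (L := L) v t) := by
  intro e₁ e₂ h
  have h1 : ins v t e₁.1 = ins v t e₂.1 := congrArg Prod.fst h
  have hx : e₁.1 = e₂.1 := ins_injective v t h1
  have h2 : slabDirs v (v.succAbove e₁.2) (Fin.succAbove_ne v e₁.2) =
      slabDirs v (v.succAbove e₂.2) (Fin.succAbove_ne v e₂.2) := congrArg Prod.snd h
  exact Prod.ext hx (Fin.succAbove_right_injective (eq_of_slabDirs_eq h2))

/-- `Re tr M* = Re tr M`. [folklore] -/
private theorem trace_star_re (M : Matrix (Fin N) (Fin N) ℂ) : (star M).trace.re = M.trace.re := by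
  rw [Matrix.star_eq_conjTranspose, Matrix.trace_conjTranspose, Complex.star_def, Complex.conj_re]

omit [NeZero L] in
/-- **The plaquette term on a slab plaquette is the slab edge term.** [cite: CaoNissimSheffield2025dynamical, §2] -/
theorem plaqTerm_slabPlaq (v : Fin (n + 1)) (t : ZMod L) (U : GaugeConfig (n + 1) L (SU N)) (e : Edge n L) :
    plaqTerm U (slabPlaq v t e) = (N : ℝ) - edgeTerm v t U e := by
  unfold plaqTerm edgeTerm slabPlaq
  by_cases h : v < v.succAbove e.2
  · have hd : slabDirs v (v.succAbove e.2) (Fin.succAbove_ne v e.2) = ⟨(v, v.succAbove e.2), h⟩ := by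
      simp [slabDirs, h]
    simp only [hd, plaquetteHolonomy, ins_shift_self, ins_shift_succAbove, Submonoid.coe_mul,
      coe_inv_SU, coe_toU_inv, slabPart, topField, botField, coe_toU]
  · have hd : slabDirs v (v.succAbove e.2) (Fin.succAbove_ne v e.2) =
        ⟨(v.succAbove e.2, v), lt_of_le_of_ne (not_lt.1 h) (Fin.succAbove_ne v e.2)⟩ := by
      simp [slabDirs, h]
    simp only [hd, plaquetteHolonomy, ins_shift_self, ins_shift_succAbove, Submonoid.coe_mul,
      coe_inv_SU, coe_toU_inv, slabPart, topField, botField, coe_toU]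
    rw [← trace_star_re]
    simp only [star_mul, star_star, mul_assoc]

/-- The sum of the slab plaquette terms. [folklore] -/
def slabSum (v : Fin (n + 1)) (t : ZMod L) (U : GaugeConfig (n + 1) L (SU N)) : ℝ :=
  ∑ e : Edge n L, plaqTerm U (slabPlaq v t e)

/-- The Wilson action of all plaquettes NOT in the slab `{x_v = t}`. [folklore] -/
def restAction (v : Fin (n + 1)) (t : ZMod L) (U : GaugeConfig (n + 1) L (SU N)) : ℝ :=
  ∑ p ∈ Finset.univ.filter (fun p => p ∉ Finset.univ.image (slabPlaq v t)), plaqTerm U p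

/-- The Wilson action = off-slab part + slab part. [cite: CaoNissimSheffield2025dynamical, §2] -/
theorem wilsonAction_eq_restAction_add_slabSum (v : Fin (n + 1)) (t : ZMod L)
    (U : GaugeConfig (n + 1) L (SU N)) :
    wilsonAction (fundamentalRep (Fin N)) U = restAction v t U + slabSum v t U := by
  classical
  rw [wilsonAction_eq_sum_plaqTerm, restAction, slabSum]
  rw [← Finset.sum_filter_add_sum_filter_not Finset.univ (fun p => p ∉ Finset.univ.image (slabPlaq v t))]
  congr 1
  have hset : Finset.univ.filter (fun p : Plaquette (n + 1) L => ¬ p ∉ Finset.univ.image (slabPlaq v t)) =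
      Finset.univ.image (slabPlaq v t) := by
    ext p; simp
  rw [hset, Finset.sum_image fun x _ y _ hxy => slabPlaq_injective v t hxy]

/-- The slab part of the action in terms of the edge terms. [folklore] -/
private theorem slabSum_eq (v : Fin (n + 1)) (t : ZMod L) (U : GaugeConfig (n + 1) L (SU N)) :
    slabSum v t U = (N : ℝ) * Fintype.card (Edge n L) - ∑ e, edgeTerm v t U e := by
  simp only [slabSum, plaqTerm_slabPlaq, Finset.sum_sub_distrib, Finset.sum_const, Finset.card_univ,
    nsmul_eq_mul, mul_comm]

omit [NeZero L] in
/-- If one of the four links of a plaquette is a vertical link of the slab `{x_v = t}`, the plaquette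
is a slab plaquette. [cite: CaoNissimSheffield2025dynamical, §2] -/
theorem mem_range_slabPlaq (v : Fin (n + 1)) (t : ZMod L) {p : Plaquette (n + 1) L}
    (h : IsSlab v t (p.1, p.2.1.1) ∨ IsSlab v t (p.1.shift p.2.1.1, p.2.1.2) ∨
      IsSlab v t (p.1.shift p.2.1.2, p.2.1.1) ∨ IsSlab v t (p.1, p.2.1.2)) :
    p ∈ Set.range (slabPlaq v t) := by
  obtain ⟨y, ⟨i, j⟩, hij⟩ := p
  simp only [IsSlab] at h
  -- reduce to the two genuine cases `i = v, y v = t` and `j = v, y v = t`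
  have h' : (i = v ∧ y v = t) ∨ (j = v ∧ y v = t) := by
    rcases h with ⟨hi, hy⟩ | ⟨hj, hy⟩ | ⟨hi, hy⟩ | ⟨hj, hy⟩
    · exact Or.inl ⟨hi, hy⟩
    · refine Or.inr ⟨hj, ?_⟩
      have hne : v ≠ i := by rintro rfl; exact (lt_irrefl _) (hj ▸ hij)
      rwa [WilsonRP.shift_apply_of_ne y hne] at hy
    · refine Or.inl ⟨hi, ?_⟩
      have hne : v ≠ j := by rintro rfl; exact (lt_irrefl _) (hi ▸ hij)
      rwa [WilsonRP.shift_apply_of_ne y hne] at hy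
    · exact Or.inr ⟨hj, hy⟩
  rcases h' with ⟨hi, hy⟩ | ⟨hj, hy⟩
  · subst hi
    obtain ⟨k, hk⟩ := Fin.exists_succAbove_eq (ne_of_gt hij)
    refine ⟨(rem i y, k), ?_⟩
    subst hy
    refine Prod.ext (ins_rem i y) (Subtype.ext ?_)
    simp only [slabPlaq, slabDirs_val, hk, if_pos hij]
  · subst hj
    obtain ⟨k, hk⟩ := Fin.exists_succAbove_eq (ne_of_lt hij)
    refine ⟨(rem j y, k), ?_⟩
    subst hy
    refine Prod.ext (ins_rem j y) (Subtype.ext ?_)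
    simp only [slabPlaq, slabDirs_val, hk, if_neg (lt_asymm hij)]

/-- The rest of the action does not see the vertical links of the slab. [cite: CaoNissimSheffield2025dynamical, §2] -/
theorem restAction_glue (v : Fin (n + 1)) (t : ZMod L) (Q Q' : Site n L → SU N)
    (r : {e : Edge (n + 1) L // ¬ IsSlab v t e} → SU N) :
    restAction v t (glue v t Q r) = restAction v t (glue v t Q' r) := by
  classical
  unfold restAction
  refine Finset.sum_congr rfl fun p hp => ?_
  have hp' : p ∉ Set.range (slabPlaq v t) := by
    simp only [Finset.mem_filter, Finset.mem_univ, true_and, Finset.mem_image, not_exists] at hp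
    rintro ⟨e, he⟩; exact hp e he
  have hns : ¬ (IsSlab v t (p.1, p.2.1.1) ∨ IsSlab v t (p.1.shift p.2.1.1, p.2.1.2) ∨
      IsSlab v t (p.1.shift p.2.1.2, p.2.1.1) ∨ IsSlab v t (p.1, p.2.1.2)) :=
    fun h => hp' (mem_range_slabPlaq v t h)
  simp only [not_or] at hns
  obtain ⟨h₁, h₂, h₃, h₄⟩ := hns
  exact plaqTerm_congr (by rw [glue_of_not_isSlab v t _ _ h₁, glue_of_not_isSlab v t _ _ h₁])
    (by rw [glue_of_not_isSlab v t _ _ h₂, glue_of_not_isSlab v t _ _ h₂])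
    (by rw [glue_of_not_isSlab v t _ _ h₃, glue_of_not_isSlab v t _ _ h₃])
    (by rw [glue_of_not_isSlab v t _ _ h₄, glue_of_not_isSlab v t _ _ h₄])

/-- **Slab decomposition of the Boltzmann weight.** With 't Hooft coupling `β` (tree coupling `Nβ`):
`exp(-Nβ S(glue Q r)) = exp(-Nβ S_rest(r)) · exp(-Nβ·N·|E(Λ^n)|) · exp(S_{A(r),B(r)}(Q))`. [cite: CaoNissimSheffield2025dynamical, §2] -/
theorem exp_neg_wilsonAction_glue (v : Fin (n + 1)) (t : ZMod L) (β : ℝ) (Q : Site n L → SU N)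
    (r : {e : Edge (n + 1) L // ¬ IsSlab v t e} → SU N) :
    Real.exp (-((N : ℝ) * β) * wilsonAction (fundamentalRep (Fin N)) (glue v t Q r)) =
      Real.exp (-((N : ℝ) * β) * restAction v t (glue v t (fun _ => 1) r)) *
        Real.exp (-((N : ℝ) * β) * ((N : ℝ) * Fintype.card (Edge n L))) *
        Real.exp (slabAction N β (topField v t (glue v t (fun _ => 1) r))
          (botField v t (glue v t (fun _ => 1) r)) Q) := by
  rw [← Real.exp_add, ← Real.exp_add]
  congr 1
  rw [wilsonAction_eq_restAction_add_slabSum v t, restAction_glue v t Q (fun _ => 1) r, slabSum_eq,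
    ← topField_glue v t Q r, ← botField_glue v t Q r]
  have h2 := slabAction_eq_sum_edgeTerm v t β (glue v t Q r)
  rw [slabPart_glue] at h2
  rw [h2]
  ring

end Action


/-! ### The slab disintegration of the torus Wilson measure (the «conditioning» of CNS §2) -/

section Peel

variable {N : ℕ} [NeZero L]

/-- `SU(N)` is second countable (a subspace of `ℂ^{N×N}`). [folklore] -/
private theorem secondCountable_SU : SecondCountableTopology (SU N) := by
  haveI : SecondCountableTopology (Matrix (Fin N) (Fin N) ℂ) :=
    inferInstanceAs (SecondCountableTopology (Fin N → Fin N → ℂ))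
  exact Topology.IsEmbedding.subtypeVal.secondCountableTopology

attribute [local instance] secondCountable_SU

/-- Product Haar measure on all links of the torus. [folklore] -/
abbrev linkMeasure (n L N : ℕ) [NeZero L] : Measure (GaugeConfig (n + 1) L (SU N)) :=
  Measure.pi fun _ : Edge (n + 1) L => haarProbability (SU N)

/-- Product Haar measure on the vertical links of one slab (= on slab spin configurations). [folklore] -/
abbrev sliceMeasure (n L N : ℕ) [NeZero L] : Measure (Site n L → SU N) :=
  Measure.pi fun _ : Site n L => haarProbability (SU N)

/-- Product Haar measure on the links off the slab. [folklore] -/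
abbrev restMeasure (v : Fin (n + 1)) (t : ZMod L) (N : ℕ) :
    Measure ({e : Edge (n + 1) L // ¬ IsSlab v t e} → SU N) :=
  Measure.pi fun _ : {e : Edge (n + 1) L // ¬ IsSlab v t e} => haarProbability (SU N)

/-- The 't Hooft-scaled Boltzmann weight `exp(-Nβ S(U))`. [folklore] -/
def weight (N : ℕ) (β : ℝ) (U : GaugeConfig (n + 1) L (SU N)) : ℝ :=
  Real.exp (-((N : ℝ) * β) * wilsonAction (fundamentalRep (Fin N)) U)

/-- The Boltzmann weight is positive. [folklore] -/
private theorem weight_pos (β : ℝ) (U : GaugeConfig (n + 1) L (SU N)) : 0 < weight N β U := Real.exp_pos _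

/-- The Boltzmann weight is measurable. [folklore] -/
private theorem measurable_weight (β : ℝ) : Measurable (weight (n := n) (L := L) N β) :=
  Real.measurable_exp.comp ((WilsonRP.measurable_wilsonAction (fundamentalRep (Fin N))
    (continuous_fundamentalRep (Fin N))).const_mul _)

/-- The Boltzmann weight is bounded. [folklore] -/
private theorem exists_weight_le (β : ℝ) : ∃ C, ∀ U : GaugeConfig (n + 1) L (SU N), weight N β U ≤ C := by
  obtain ⟨B, hB⟩ := exists_abs_wilsonAction_le (d := n + 1) (L := L) (fundamentalRep (Fin N))
    (continuous_fundamentalRep (Fin N))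
  refine ⟨Real.exp (|(N : ℝ) * β| * B), fun U => Real.exp_le_exp.2 ?_⟩
  have h1 : -((N : ℝ) * β) * wilsonAction (fundamentalRep (Fin N)) U ≤
      |-((N : ℝ) * β) * wilsonAction (fundamentalRep (Fin N)) U| := le_abs_self _
  rw [abs_mul, abs_neg] at h1
  exact h1.trans (mul_le_mul_of_nonneg_left (hB U) (abs_nonneg _))

/-- The slab action of the slab `{x_v = t}` read off a torus configuration. [folklore] -/
def slabActionOf (v : Fin (n + 1)) (t : ZMod L) (β : ℝ) (U : GaugeConfig (n + 1) L (SU N)) : ℝ :=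
  slabAction N β (topField v t U) (botField v t U) (slabPart v t U)

omit [NeZero L] in
/-- Edge terms are continuous in the configuration. [folklore] -/
private theorem continuous_edgeTerm (v : Fin (n + 1)) (t : ZMod L) (e : Edge n L) :
    Continuous fun U : GaugeConfig (n + 1) L (SU N) => edgeTerm v t U e := by
  unfold edgeTerm slabPart topField botField
  simp only [coe_toU, coe_toU_inv, coe_inv_SU]
  refine Complex.continuous_re.comp (Continuous.matrix_trace ?_)
  refine Continuous.mul (Continuous.mul (Continuous.mul ?_ ?_) ?_) ?_
  · exact continuous_subtype_val.comp (continuous_apply _)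
  · exact continuous_subtype_val.comp (continuous_apply _)
  · exact (continuous_subtype_val.comp (continuous_apply _)).star
  · exact (continuous_subtype_val.comp (continuous_apply _)).star

/-- The slab action is continuous in the configuration. [folklore] -/
private theorem continuous_slabActionOf (v : Fin (n + 1)) (t : ZMod L) (β : ℝ) :
    Continuous (slabActionOf (n := n) (L := L) (N := N) v t β) := by
  unfold slabActionOf
  simp only [slabAction_eq_sum_edgeTerm]
  exact continuous_const.mul (continuous_finsetSum _ fun e _ => continuous_edgeTerm v t e)

/-- The slab action is measurable in the configuration. [folklore] -/
private theorem measurable_slabActionOf (v : Fin (n + 1)) (t : ZMod L) (β : ℝ) :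
    Measurable (slabActionOf (n := n) (L := L) (N := N) v t β) :=
  (continuous_slabActionOf v t β).measurable

omit [NeZero L] in
/-- `|Re Tr(unitary)| ≤ N` for an edge term. [folklore] -/
private theorem abs_edgeTerm_le (v : Fin (n + 1)) (t : ZMod L) (U : GaugeConfig (n + 1) L (SU N)) (e : Edge n L) :
    |edgeTerm v t U e| ≤ N := by
  unfold edgeTerm
  set M : Matrix (Fin N) (Fin N) ℂ := ((slabPart v t U e.1 : SU N) : Matrix (Fin N) (Fin N) ℂ) *
    (topField v t U e : Matrix (Fin N) (Fin N) ℂ) * ((slabPart v t U (e.1.shift e.2))⁻¹ : SU N) *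
      ((botField v t U e)⁻¹ : UN N) with hM
  have hMu : M ∈ Matrix.unitaryGroup (Fin N) ℂ := by
    rw [hM]
    refine Submonoid.mul_mem _ (Submonoid.mul_mem _ (Submonoid.mul_mem _ ?_ (topField v t U e).2) ?_)
      ((botField v t U e)⁻¹).2
    · exact (slabPart v t U e.1).2.1
    · exact ((slabPart v t U (e.1.shift e.2))⁻¹).2.1
  have hentry : ∀ i j, ‖M i j‖ ≤ 1 := fun i j => entry_norm_bound_of_unitary hMu i j
  calc |(M.trace).re| ≤ ‖M.trace‖ := Complex.abs_re_le_norm _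
    _ = ‖∑ i, M i i‖ := by rw [Matrix.trace]; rfl
    _ ≤ ∑ i, ‖M i i‖ := norm_sum_le _ _
    _ ≤ ∑ _i : Fin N, (1 : ℝ) := Finset.sum_le_sum fun i _ => hentry i i
    _ = N := by simp

/-- The slab action is bounded by `N|β| · N |E(Λ^n)|`. [folklore] -/
private theorem abs_slabActionOf_le (v : Fin (n + 1)) (t : ZMod L) (β : ℝ) (U : GaugeConfig (n + 1) L (SU N)) :
    |slabActionOf v t β U| ≤ (N : ℝ) * |β| * ((N : ℝ) * Fintype.card (Edge n L)) := by
  unfold slabActionOf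
  rw [slabAction_eq_sum_edgeTerm, abs_mul, abs_mul, Nat.abs_cast]
  refine mul_le_mul_of_nonneg_left ?_ (by positivity)
  refine (Finset.abs_sum_le_sum_abs _ _).trans ?_
  calc ∑ e, |edgeTerm v t U e| ≤ ∑ _e : Edge n L, (N : ℝ) := Finset.sum_le_sum fun e _ => abs_edgeTerm_le v t U e
    _ = (N : ℝ) * Fintype.card (Edge n L) := by simp [mul_comm]

/-- The slab `σ`-model law of the slab `{x_v = t}` given the off-slab links `r` (CNS Def. 2.1 with
`A` = links at height `t+1`, `B` = links at height `t`). [cite: CaoNissimSheffield2025dynamical, Definition 2.1] -/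
def slabLaw (v : Fin (n + 1)) (t : ZMod L) (β : ℝ) (r : {e : Edge (n + 1) L // ¬ IsSlab v t e} → SU N) :
    Measure (Site n L → SU N) :=
  slabMeasure N β (topField v t (glue v t (fun _ => 1) r)) (botField v t (glue v t (fun _ => 1) r))

/-- Instance (plumbing). [folklore] -/
instance (v : Fin (n + 1)) (t : ZMod L) (β : ℝ) (r : {e : Edge (n + 1) L // ¬ IsSlab v t e} → SU N) :
    IsProbabilityMeasure (slabLaw v t β r) := by
  unfold slabLaw; exact isProbabilityMeasure_slabMeasure N β _ _

/-- The slab action of a glued configuration is `S_{A(r),B(r)}(Q)`. [folklore] -/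
private theorem slabActionOf_glue (v : Fin (n + 1)) (t : ZMod L) (β : ℝ) (Q : Site n L → SU N)
    (r : {e : Edge (n + 1) L // ¬ IsSlab v t e} → SU N) :
    slabActionOf v t β (glue v t Q r) =
      slabAction N β (topField v t (glue v t (fun _ => 1) r)) (botField v t (glue v t (fun _ => 1) r)) Q := by
  rw [slabActionOf, topField_glue v t Q r, botField_glue v t Q r, slabPart_glue]

/-- The slab law as a tilted product Haar measure. [folklore] -/
private theorem slabLaw_eq_tilted (v : Fin (n + 1)) (t : ZMod L) (β : ℝ)
    (r : {e : Edge (n + 1) L // ¬ IsSlab v t e} → SU N) :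
    slabLaw v t β r = (sliceMeasure n L N).tilted fun Q => slabActionOf v t β (glue v t Q r) := by
  simp only [slabActionOf_glue]
  rfl

/-- The slab partition function `Z_{A(r),B(r)}`. [folklore] -/
def slabZ (v : Fin (n + 1)) (t : ZMod L) (β : ℝ) (r : {e : Edge (n + 1) L // ¬ IsSlab v t e} → SU N) : ℝ :=
  ∫ Q, Real.exp (slabActionOf v t β (glue v t Q r)) ∂(sliceMeasure n L N)

/-- `exp(S_{A(r),B(r)})` is integrable. [folklore] -/
private theorem integrable_exp_slabActionOf_glue (v : Fin (n + 1)) (t : ZMod L) (β : ℝ)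
    (r : {e : Edge (n + 1) L // ¬ IsSlab v t e} → SU N) :
    Integrable (fun Q => Real.exp (slabActionOf v t β (glue v t Q r))) (sliceMeasure n L N) := by
  refine Integrable.of_bound ?_ (Real.exp ((N : ℝ) * |β| * ((N : ℝ) * Fintype.card (Edge n L))))
    (ae_of_all _ fun Q => ?_)
  · refine (Real.measurable_exp.comp ((measurable_slabActionOf v t β).comp ?_)).aestronglyMeasurable
    exact (measurable_glue v t).comp (measurable_id.prodMk measurable_const)
  · rw [Real.norm_eq_abs, Real.abs_exp]
    exact Real.exp_le_exp.2 ((le_abs_self _).trans (abs_slabActionOf_le v t β _))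

/-- The slab partition function is positive. [folklore] -/
private theorem slabZ_pos (v : Fin (n + 1)) (t : ZMod L) (β : ℝ) (r : {e : Edge (n + 1) L // ¬ IsSlab v t e} → SU N) :
    0 < slabZ v t β r :=
  integral_exp_pos (integrable_exp_slabActionOf_glue v t β r)

/-- The weight of the off-slab configuration `r` after integrating out the slab:
`exp(-Nβ S_rest(r)) exp(-Nβ N |E(Λ^n)|) Z_{A(r),B(r)}`. [folklore] -/
def slabWeight (v : Fin (n + 1)) (t : ZMod L) (β : ℝ) (r : {e : Edge (n + 1) L // ¬ IsSlab v t e} → SU N) : ℝ :=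
  Real.exp (-((N : ℝ) * β) * restAction v t (glue v t (fun _ => 1) r)) *
    Real.exp (-((N : ℝ) * β) * ((N : ℝ) * Fintype.card (Edge n L))) * slabZ v t β r

/-- The Boltzmann weight of a glued configuration factorises. [folklore] -/
private theorem weight_glue (v : Fin (n + 1)) (t : ZMod L) (β : ℝ) (Q : Site n L → SU N)
    (r : {e : Edge (n + 1) L // ¬ IsSlab v t e} → SU N) :
    weight N β (glue v t Q r) =
      Real.exp (-((N : ℝ) * β) * restAction v t (glue v t (fun _ => 1) r)) *
        Real.exp (-((N : ℝ) * β) * ((N : ℝ) * Fintype.card (Edge n L))) *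
        Real.exp (slabActionOf v t β (glue v t Q r)) := by
  rw [weight, exp_neg_wilsonAction_glue, slabActionOf_glue]

/-- Integration against a tilted measure, un-normalised: `∫ e^{f} g dμ = (∫ e^f dμ) ∫ g d(μ.tilted f)`
(complex-valued `g`). [folklore] -/
private theorem integral_exp_mul_eq_mul_integral_tilted {α : Type*} [MeasurableSpace α] (μ : Measure α)
    (f : α → ℝ) (g : α → ℂ) (hZ : (∫ x, Real.exp (f x) ∂μ) ≠ 0) :
    ∫ x, (Real.exp (f x) : ℂ) * g x ∂μ =
      ((∫ x, Real.exp (f x) ∂μ : ℝ) : ℂ) * ∫ x, g x ∂(μ.tilted f) := by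
  rw [integral_tilted, ← integral_const_mul]
  refine integral_congr_ae (ae_of_all _ fun x => ?_)
  simp only [Complex.real_smul, ← mul_assoc, ← Complex.ofReal_mul]
  congr 2
  field_simp

/-- **The slab disintegration** (the «conditioning on the links orthogonal to the vertical side» of
CNS §2, made explicit): integrating a bounded measurable `F` against the 't Hooft-scaled Wilson
weight = integrating over the off-slab links `r`, with weight `slabWeight r ≥ 0`, the slab-`σ`-model
expectation of `F(glue · r)`. [cite: CaoNissimSheffield2025dynamical, §2] -/
theorem integral_weight_mul_eq (v : Fin (n + 1)) (t : ZMod L) (β : ℝ)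
    (F : GaugeConfig (n + 1) L (SU N) → ℂ) (hF : Measurable F) (C : ℝ) (hC : ∀ U, ‖F U‖ ≤ C) :
    ∫ U, (weight N β U : ℂ) * F U ∂(linkMeasure n L N) =
      ∫ r, (slabWeight v t β r : ℂ) * ∫ Q, F (glue v t Q r) ∂(slabLaw v t β r) ∂(restMeasure v t N) := by
  -- (1) transport to the product space
  have hmp := measurePreserving_splitEquiv (n := n) (L := L) v t (haarProbability (SU N))
  have h1 : ∫ U, (weight N β U : ℂ) * F U ∂(linkMeasure n L N) =
      ∫ p, (weight N β (glue v t p.1 p.2) : ℂ) * F (glue v t p.1 p.2)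
        ∂((sliceMeasure n L N).prod (restMeasure v t N)) := by
    rw [← (hmp.symm _).integral_comp']
    rfl
  rw [h1]
  -- (2) Fubini, `r` outside
  obtain ⟨Cw, hCw⟩ := exists_weight_le (n := n) (L := L) (N := N) β
  have hint : Integrable (fun p : (Site n L → SU N) × ({e : Edge (n + 1) L // ¬ IsSlab v t e} → SU N) =>
      (weight N β (glue v t p.1 p.2) : ℂ) * F (glue v t p.1 p.2))
      ((sliceMeasure n L N).prod (restMeasure v t N)) := by
    refine Integrable.of_bound ?_ (Cw * C) (ae_of_all _ fun p => ?_)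
    · refine Measurable.aestronglyMeasurable ?_
      exact ((Complex.measurable_ofReal.comp (measurable_weight β)).comp (measurable_glue v t)).mul
        (hF.comp (measurable_glue v t))
    · rw [norm_mul, Complex.norm_real, Real.norm_eq_abs, abs_of_pos (weight_pos β _)]
      exact mul_le_mul (hCw _) (hC _) (norm_nonneg _)
        ((weight_pos β (glue v t p.1 p.2)).le.trans (hCw (glue v t p.1 p.2)))
  rw [integral_prod_symm _ hint]
  -- (3) the inner integral, for each `r`
  refine integral_congr_ae (ae_of_all _ fun r => ?_)
  simp only [weight_glue, Complex.ofReal_mul, mul_assoc]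
  rw [integral_const_mul, integral_const_mul, slabWeight, Complex.ofReal_mul, Complex.ofReal_mul, mul_assoc,
    mul_assoc]
  congr 2
  rw [slabLaw_eq_tilted, slabZ]
  exact integral_exp_mul_eq_mul_integral_tilted _ _ _ (slabZ_pos v t β r).ne'

/-- The off-slab weight is non-negative. [folklore] -/
private theorem slabWeight_nonneg (v : Fin (n + 1)) (t : ZMod L) (β : ℝ)
    (r : {e : Edge (n + 1) L // ¬ IsSlab v t e} → SU N) : 0 ≤ slabWeight v t β r :=
  mul_nonneg (mul_nonneg (Real.exp_pos _).le (Real.exp_pos _).le) (slabZ_pos v t β r).le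

end Peel


/-! ### Replacing a slab factor by its slab expectation -/

section SlabAvg

variable {N : ℕ} [NeZero L]

attribute [local instance] secondCountable_SU

omit [NeZero L] in
/-- The rest part is a measurable function of the configuration. [folklore] -/
private theorem measurable_restPart (v : Fin (n + 1)) (t : ZMod L) :
    Measurable (restPart (G := SU N) (L := L) v t) :=
  measurable_pi_lambda _ fun _ => measurable_pi_apply _

/-- The slab expectation `E_{A(r),B(r)}[Ψ(glue · r)]` of an observable, as a function of the
off-slab links. [folklore] -/
def slabAvg (v : Fin (n + 1)) (t : ZMod L) (β : ℝ) (Ψ : GaugeConfig (n + 1) L (SU N) → ℂ)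
    (r : {e : Edge (n + 1) L // ¬ IsSlab v t e} → SU N) : ℂ :=
  ∫ Q, Ψ (glue v t Q r) ∂(slabLaw v t β r)

/-- Slab expectations of bounded observables are bounded. [folklore] -/
private theorem norm_slabAvg_le (v : Fin (n + 1)) (t : ZMod L) (β : ℝ) {Ψ : GaugeConfig (n + 1) L (SU N) → ℂ}
    {C : ℝ} (hC : ∀ U, ‖Ψ U‖ ≤ C) (r : {e : Edge (n + 1) L // ¬ IsSlab v t e} → SU N) :
    ‖slabAvg v t β Ψ r‖ ≤ C := by
  have h := norm_integral_le_of_norm_le_const (μ := slabLaw v t β r) (f := fun Q => Ψ (glue v t Q r))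
    (ae_of_all _ fun Q => hC _)
  simpa [slabAvg] using h

/-- The slab expectation as an un-normalised product-Haar integral. [folklore] -/
private theorem slabAvg_eq (v : Fin (n + 1)) (t : ZMod L) (β : ℝ) (Ψ : GaugeConfig (n + 1) L (SU N) → ℂ)
    (r : {e : Edge (n + 1) L // ¬ IsSlab v t e} → SU N) :
    slabAvg v t β Ψ r = ((slabZ v t β r)⁻¹ : ℝ) •
      ∫ Q, (Real.exp (slabActionOf v t β (glue v t Q r)) : ℂ) * Ψ (glue v t Q r) ∂(sliceMeasure n L N) := by
  rw [slabAvg, slabLaw_eq_tilted, integral_exp_mul_eq_mul_integral_tilted _ _ _ (slabZ_pos v t β r).ne',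
    ← slabZ, Complex.real_smul, ← mul_assoc, ← Complex.ofReal_mul,
    inv_mul_cancel₀ (slabZ_pos v t β r).ne', Complex.ofReal_one, one_mul]

/-- Slab expectations are measurable in the off-slab links (Fubini measurability). [folklore] -/
private theorem measurable_slabAvg (v : Fin (n + 1)) (t : ZMod L) (β : ℝ) {Ψ : GaugeConfig (n + 1) L (SU N) → ℂ}
    (hΨ : Measurable Ψ) : Measurable (slabAvg v t β Ψ) := by
  have hfun : slabAvg v t β Ψ = fun r => ((slabZ v t β r)⁻¹ : ℝ) •
      ∫ Q, (Real.exp (slabActionOf v t β (glue v t Q r)) : ℂ) * Ψ (glue v t Q r) ∂(sliceMeasure n L N) :=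
    funext fun r => slabAvg_eq v t β Ψ r
  rw [hfun]
  have hE : Measurable fun p : (Site n L → SU N) × ({e : Edge (n + 1) L // ¬ IsSlab v t e} → SU N) =>
      Real.exp (slabActionOf v t β (glue v t p.1 p.2)) :=
    Real.measurable_exp.comp ((measurable_slabActionOf v t β).comp (measurable_glue v t))
  have hZ : Measurable (slabZ (n := n) (L := L) (N := N) v t β) := by
    have := (hE.stronglyMeasurable).integral_prod_left' (μ := sliceMeasure n L N)
    exact this.measurable
  have hI : Measurable fun r : {e : Edge (n + 1) L // ¬ IsSlab v t e} → SU N =>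
      ∫ Q, (Real.exp (slabActionOf v t β (glue v t Q r)) : ℂ) * Ψ (glue v t Q r) ∂(sliceMeasure n L N) := by
    have hm : Measurable fun p : (Site n L → SU N) × ({e : Edge (n + 1) L // ¬ IsSlab v t e} → SU N) =>
        (Real.exp (slabActionOf v t β (glue v t p.1 p.2)) : ℂ) * Ψ (glue v t p.1 p.2) :=
      (Complex.measurable_ofReal.comp hE).mul (hΨ.comp (measurable_glue v t))
    exact ((hm.stronglyMeasurable).integral_prod_left' (μ := sliceMeasure n L N)).measurable
  exact (measurable_inv.comp hZ).smul hI

/-- **Conditioning on the off-slab links**: inside the Wilson integral, a bounded factor `Ψ` may be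
replaced by its slab expectation when the cofactor `G` does not depend on the vertical links of
the slab. [cite: CaoNissimSheffield2025dynamical, §2] -/
theorem integral_weight_mul_mul_eq_slabAvg (v : Fin (n + 1)) (t : ZMod L) (β : ℝ)
    (G Ψ : GaugeConfig (n + 1) L (SU N) → ℂ) (hG : Measurable G) (hΨ : Measurable Ψ) (CG CΨ : ℝ)
    (hCG : ∀ U, ‖G U‖ ≤ CG) (hCΨ : ∀ U, ‖Ψ U‖ ≤ CΨ)
    (hGslab : ∀ Q r, G (glue v t Q r) = G (glue v t (fun _ => 1) r)) :
    ∫ U, (weight N β U : ℂ) * (G U * Ψ U) ∂(linkMeasure n L N) =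
      ∫ U, (weight N β U : ℂ) * (G U * slabAvg v t β Ψ (restPart v t U)) ∂(linkMeasure n L N) := by
  have hCG0 : 0 ≤ CG := (norm_nonneg _).trans (hCG fun _ => 1)
  have hb1 : ∀ U, ‖G U * Ψ U‖ ≤ CG * CΨ := fun U => by
    rw [norm_mul]; exact mul_le_mul (hCG U) (hCΨ U) (norm_nonneg _) hCG0
  have hb2 : ∀ U, ‖G U * slabAvg v t β Ψ (restPart v t U)‖ ≤ CG * CΨ := fun U => by
    rw [norm_mul]; exact mul_le_mul (hCG U) (norm_slabAvg_le v t β hCΨ _) (norm_nonneg _) hCG0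
  rw [integral_weight_mul_eq v t β (fun U => G U * Ψ U) (hG.mul hΨ) _ hb1,
    integral_weight_mul_eq v t β (fun U => G U * slabAvg v t β Ψ (restPart v t U))
      (hG.mul ((measurable_slabAvg v t β hΨ).comp (measurable_restPart v t))) _ hb2]
  refine integral_congr_ae (ae_of_all _ fun r => ?_)
  simp only [hGslab, restPart_glue]
  rw [integral_const_mul, integral_const_mul, integral_const, probReal_univ, one_smul]
  rfl

end SlabAvg

/-! ### Centre symmetry of the slab `σ`-models: one-point functions vanish (CNS §2, `zI ∈ G`) -/

section Centre

variable {N : ℕ} [NeZero L]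

attribute [local instance] secondCountable_SU

/-- The primitive `N`-th root of unity `e^{2πi/N}`. [folklore] -/
def rootOfUnity (N : ℕ) : ℂ := Complex.exp (2 * Real.pi * Complex.I / N)

/-- `e^{2πi/N}` is a primitive `N`-th root of unity. [folklore] -/
private theorem isPrimitiveRoot_rootOfUnity (hN : N ≠ 0) : IsPrimitiveRoot (rootOfUnity N) N :=
  Complex.isPrimitiveRoot_exp N hN

/-- `|e^{2πi/N}| = 1`. [folklore] -/
private theorem norm_rootOfUnity (hN : N ≠ 0) : ‖rootOfUnity N‖ = 1 :=
  (isPrimitiveRoot_rootOfUnity hN).norm'_eq_one hN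

/-- `z z̄ = 1` for `z = e^{2πi/N}`. [folklore] -/
private theorem rootOfUnity_mul_conj (hN : N ≠ 0) :
    rootOfUnity N * (starRingEnd ℂ) (rootOfUnity N) = 1 := by
  rw [Complex.mul_conj, Complex.normSq_eq_norm_sq, norm_rootOfUnity hN]; simp

/-- `z̄ z = 1` for `z = e^{2πi/N}`. [folklore] -/
private theorem conj_mul_rootOfUnity (hN : N ≠ 0) :
    (starRingEnd ℂ) (rootOfUnity N) * rootOfUnity N = 1 := by
  rw [mul_comm]; exact rootOfUnity_mul_conj hN

/-- `e^{2πi/N} ≠ 1` for `N ≥ 2`. [folklore] -/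
private theorem rootOfUnity_ne_one (hN : 2 ≤ N) : rootOfUnity N ≠ 1 :=
  (isPrimitiveRoot_rootOfUnity (by omega)).ne_one hN

/-- The central element `e^{2πi/N} I` of `SU(N)`. [cite: CaoNissimSheffield2025dynamical, Theorem 2.3] -/
def centre (N : ℕ) (hN : N ≠ 0) : SU N :=
  ⟨rootOfUnity N • (1 : Matrix (Fin N) (Fin N) ℂ), by
    rw [Matrix.mem_specialUnitaryGroup_iff]
    refine ⟨?_, ?_⟩
    · rw [Matrix.mem_unitaryGroup_iff, star_smul, Matrix.star_eq_conjTranspose, Matrix.conjTranspose_one,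
        smul_mul_smul_comm, one_mul, Complex.star_def, rootOfUnity_mul_conj hN, one_smul]
    · rw [Matrix.det_smul, Matrix.det_one, mul_one, Fintype.card_fin,
        (isPrimitiveRoot_rootOfUnity hN).pow_eq_one]⟩

/-- The centre element as a matrix. [folklore] -/
@[simp] private theorem coe_centre (hN : N ≠ 0) :
    ((centre N hN : SU N) : Matrix (Fin N) (Fin N) ℂ) = rootOfUnity N • (1 : Matrix (Fin N) (Fin N) ℂ) := rfl

/-- Multiplication by the centre element scales the matrix. [folklore] -/
private theorem coe_centre_mul (hN : N ≠ 0) (g : SU N) :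
    ((centre N hN * g : SU N) : Matrix (Fin N) (Fin N) ℂ) = rootOfUnity N • (g : Matrix (Fin N) (Fin N) ℂ) := by
  rw [Submonoid.coe_mul, coe_centre, Matrix.smul_mul, one_mul]

/-- Multiplication of every spin by the central element. [folklore] -/
def centreMul (hN : N ≠ 0) : (Site n L → SU N) ≃ᵐ (Site n L → SU N) :=
  MeasurableEquiv.piCongrRight fun _ => MeasurableEquiv.mulLeft (centre N hN)

omit [NeZero L] in
/-- `centreMul`, evaluated. [folklore] -/
private theorem centreMul_apply (hN : N ≠ 0) (Q : Site n L → SU N) (x : Site n L) :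
    centreMul hN Q x = centre N hN * Q x := rfl

/-- Multiplication by the centre preserves product Haar measure (left invariance). [folklore] -/
private theorem measurePreserving_centreMul (hN : N ≠ 0) :
    MeasurePreserving (centreMul (n := n) (L := L) hN) (sliceMeasure n L N) (sliceMeasure n L N) :=
  measurePreserving_pi _ _ fun _ => measurePreserving_mul_left (haarProbability (SU N)) _

omit [NeZero L] in
/-- The centre drops out of every slab term. [folklore] -/
private theorem centre_term (hN : N ≠ 0) (g h : SU N) (A B : Matrix (Fin N) (Fin N) ℂ) :
    ((centre N hN * g : SU N) : Matrix (Fin N) (Fin N) ℂ) * A * ((centre N hN * h)⁻¹ : SU N) * B =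
      (g : Matrix (Fin N) (Fin N) ℂ) * A * (h⁻¹ : SU N) * B := by
  rw [coe_centre_mul, coe_inv_SU, coe_inv_SU, coe_centre_mul, star_smul]
  simp only [Matrix.smul_mul, Matrix.mul_smul, smul_smul, Complex.star_def, conj_mul_rootOfUnity hN, one_smul]

/-- The slab action is invariant under the centre. [cite: CaoNissimSheffield2025dynamical, §2] -/
theorem slabAction_centreMul (hN : N ≠ 0) (β : ℝ) (A B : Edge n L → UN N) (Q : Site n L → SU N) :
    slabAction N β A B (centreMul hN Q) = slabAction N β A B Q := by
  simp only [slabAction, centreMul_apply, centre_term]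

/-- Integrals against the slab `σ`-model are invariant under the centre. [cite: CaoNissimSheffield2025dynamical, §2] -/
theorem integral_slabMeasure_centreMul (hN : N ≠ 0) (β : ℝ) (A B : Edge n L → UN N)
    (F : (Site n L → SU N) → ℂ) :
    ∫ Q, F (centreMul hN Q) ∂(slabMeasure N β A B) = ∫ Q, F Q ∂(slabMeasure N β A B) := by
  unfold slabMeasure
  rw [integral_tilted, integral_tilted]
  have h := (measurePreserving_centreMul (n := n) (L := L) hN).integral_comp'
    (fun Q => (Real.exp (slabAction N β A B Q) / ∫ Q', Real.exp (slabAction N β A B Q')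
      ∂(sliceMeasure n L N)) • F Q)
  simp only [slabAction_centreMul] at h
  rw [← h]

/-- Bounded measurable observables are integrable for the slab model. [folklore] -/
private theorem integrable_slabMeasure_of_bounded (β : ℝ) (A B : Edge n L → UN N) {F : (Site n L → SU N) → ℂ}
    (hF : Measurable F) {C : ℝ} (hC : ∀ Q, ‖F Q‖ ≤ C) : Integrable F (slabMeasure N β A B) := by
  haveI := isProbabilityMeasure_slabMeasure (n := n) (L := L) N β A B
  exact Integrable.of_bound hF.aestronglyMeasurable C (ae_of_all _ hC)

/-- Matrix entries of a spin are measurable. [folklore] -/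
private theorem measurable_entry (x : Site n L) (i j : Fin N) :
    Measurable fun Q : Site n L → SU N => ((Q x : SU N) : Matrix (Fin N) (Fin N) ℂ) i j :=
  ((continuous_subtype_val.comp (continuous_apply x)).matrix_elem i j).measurable

/-- Matrix entries of an inverse spin are measurable. [folklore] -/
private theorem measurable_inv_entry (x : Site n L) (i j : Fin N) :
    Measurable fun Q : Site n L → SU N => (((Q x)⁻¹ : SU N) : Matrix (Fin N) (Fin N) ℂ) i j :=
  ((continuous_subtype_val.comp ((continuous_apply x).inv)).matrix_elem i j).measurable

omit [NeZero L] in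
/-- Entries of an `SU(N)` matrix have norm `≤ 1`. [folklore] -/
private theorem norm_entry_le (g : SU N) (i j : Fin N) : ‖(g : Matrix (Fin N) (Fin N) ℂ) i j‖ ≤ 1 :=
  entry_norm_bound_of_unitary g.2.1 i j

/-- **One-point functions vanish**: `E_{A,B}[(Q_x)_{ij}] = 0` (`= z E_{A,B}[(Q_x)_{ij}]`, `z ≠ 1`). [cite: CaoNissimSheffield2025dynamical, §2] -/
theorem integral_entry_eq_zero (hN : 2 ≤ N) (β : ℝ) (A B : Edge n L → UN N) (x : Site n L) (i j : Fin N) :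
    ∫ Q, ((Q x : SU N) : Matrix (Fin N) (Fin N) ℂ) i j ∂(slabMeasure N β A B) = 0 := by
  have hN0 : N ≠ 0 := by omega
  have h := integral_slabMeasure_centreMul (n := n) (L := L) hN0 β A B
    (fun Q => ((Q x : SU N) : Matrix (Fin N) (Fin N) ℂ) i j)
  simp only [centreMul_apply, coe_centre_mul, Matrix.smul_apply, smul_eq_mul] at h
  rw [integral_const_mul] at h
  have h1 : (rootOfUnity N - 1) * ∫ Q, ((Q x : SU N) : Matrix (Fin N) (Fin N) ℂ) i j ∂(slabMeasure N β A B) = 0 := by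
    rw [sub_mul, one_mul, h, sub_self]
  rcases mul_eq_zero.1 h1 with h2 | h2
  · exact absurd (sub_eq_zero.1 h2) (rootOfUnity_ne_one hN)
  · exact h2

/-- **One-point functions vanish**: `E_{A,B}[(Q_x⁻¹)_{ij}] = 0`. [cite: CaoNissimSheffield2025dynamical, §2] -/
theorem integral_inv_entry_eq_zero (hN : 2 ≤ N) (β : ℝ) (A B : Edge n L → UN N) (x : Site n L) (i j : Fin N) :
    ∫ Q, (((Q x)⁻¹ : SU N) : Matrix (Fin N) (Fin N) ℂ) i j ∂(slabMeasure N β A B) = 0 := by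
  have hN0 : N ≠ 0 := by omega
  have h := integral_slabMeasure_centreMul (n := n) (L := L) hN0 β A B
    (fun Q => (((Q x)⁻¹ : SU N) : Matrix (Fin N) (Fin N) ℂ) i j)
  simp only [centreMul_apply, coe_inv_SU, coe_centre_mul, star_smul, Matrix.smul_apply, smul_eq_mul] at h
  rw [integral_const_mul] at h
  have h1 : (star (rootOfUnity N) - 1) *
      ∫ Q, (((Q x)⁻¹ : SU N) : Matrix (Fin N) (Fin N) ℂ) i j ∂(slabMeasure N β A B) = 0 := by
    rw [sub_mul, one_mul]
    simp only [coe_inv_SU]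
    rw [h, sub_self]
  rcases mul_eq_zero.1 h1 with h2 | h2
  · exfalso
    have h3 : star (rootOfUnity N) = 1 := sub_eq_zero.1 h2
    have h4 : rootOfUnity N = 1 := by simpa using congrArg star h3
    exact rootOfUnity_ne_one hN h4
  · simpa only [coe_inv_SU] using h2

end Centre


/-! ### Two-point functions of the slab models are covariances (CNS §2) -/

section TwoPoint

variable {N : ℕ} [NeZero L]

attribute [local instance] secondCountable_SU

open ProbabilityTheory

/-- **`E_{A,B}[(Q_x)_{ab} (Q_y⁻¹)_{cd}] = Cov`, bounded by the clustering hypothesis.** The complex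
two-point function splits into the four real covariances of `Re/Im` parts (the one-point functions
vanish by centre symmetry). [cite: CaoNissimSheffield2025dynamical, §2] -/
theorem norm_integral_entry_mul_inv_entry_le (hN : 2 ≤ N) (β : ℝ) (A B : Edge n L → UN N) {C₁ C₂ : ℝ}
    (hcov : ∀ (x y : Site n L) (i j k l : Fin N) (φ ψ : ℂ → ℝ),
      (φ = Complex.re ∨ φ = Complex.im) → (ψ = Complex.re ∨ ψ = Complex.im) →
        |cov[fun Q => φ ((Q x : Matrix (Fin N) (Fin N) ℂ) i j),
            fun Q => ψ ((((Q y)⁻¹ : Matrix.specialUnitaryGroup (Fin N) ℂ) :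
              Matrix (Fin N) (Fin N) ℂ) k l); slabMeasure N β A B]| ≤ C₁ * Real.exp (-C₂ * torusGraphDist x y))
    (x y : Site n L) (a b c d : Fin N) :
    ‖∫ Q, ((Q x : SU N) : Matrix (Fin N) (Fin N) ℂ) a b * (((Q y)⁻¹ : SU N) : Matrix (Fin N) (Fin N) ℂ) c d
        ∂(slabMeasure N β A B)‖ ≤ 4 * C₁ * Real.exp (-C₂ * torusGraphDist x y) := by
  haveI := isProbabilityMeasure_slabMeasure (n := n) (L := L) N β A B
  set μ := slabMeasure (n := n) (L := L) N β A B with hμ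
  set f : (Site n L → SU N) → ℂ := fun Q => ((Q x : SU N) : Matrix (Fin N) (Fin N) ℂ) a b with hf
  set g : (Site n L → SU N) → ℂ := fun Q => (((Q y)⁻¹ : SU N) : Matrix (Fin N) (Fin N) ℂ) c d with hg
  have hfm : Measurable f := measurable_entry x a b
  have hgm : Measurable g := measurable_inv_entry y c d
  have hfb : ∀ Q, ‖f Q‖ ≤ 1 := fun Q => norm_entry_le _ a b
  have hgb : ∀ Q, ‖g Q‖ ≤ 1 := fun Q => norm_entry_le _ c d
  -- real and imaginary parts
  set fr : (Site n L → SU N) → ℝ := fun Q => (f Q).re with hfr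
  set fi : (Site n L → SU N) → ℝ := fun Q => (f Q).im with hfi
  set gr : (Site n L → SU N) → ℝ := fun Q => (g Q).re with hgr
  set gi : (Site n L → SU N) → ℝ := fun Q => (g Q).im with hgi
  -- bounded real observables: square integrable, and products integrable
  have hre1 : ∀ {h : (Site n L → SU N) → ℂ}, (∀ Q, ‖h Q‖ ≤ 1) → ∀ Q, ‖(h Q).re‖ ≤ 1 :=
    fun hb Q => (Complex.abs_re_le_norm _).trans (hb Q)
  have him1 : ∀ {h : (Site n L → SU N) → ℂ}, (∀ Q, ‖h Q‖ ≤ 1) → ∀ Q, ‖(h Q).im‖ ≤ 1 :=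
    fun hb Q => (Complex.abs_im_le_norm _).trans (hb Q)
  have hL2 : ∀ {u : (Site n L → SU N) → ℝ}, Measurable u → (∀ Q, ‖u Q‖ ≤ 1) → MemLp u 2 μ :=
    fun hm hb => MemLp.of_bound hm.aestronglyMeasurable 1 (ae_of_all _ hb)
  have hmul : ∀ {u w : (Site n L → SU N) → ℝ}, Measurable u → Measurable w → (∀ Q, ‖u Q‖ ≤ 1) →
      (∀ Q, ‖w Q‖ ≤ 1) → Integrable (fun Q => u Q * w Q) μ := fun hu hw hub hwb =>
    Integrable.of_bound (hu.mul hw).aestronglyMeasurable 1 (ae_of_all _ fun Q => by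
      rw [norm_mul]; exact mul_le_one₀ (hub Q) (norm_nonneg _) (hwb Q))
  have hfrm : Measurable fr := Complex.measurable_re.comp hfm
  have hfim : Measurable fi := Complex.measurable_im.comp hfm
  have hgrm : Measurable gr := Complex.measurable_re.comp hgm
  have hgim : Measurable gi := Complex.measurable_im.comp hgm
  have hfr2 : MemLp fr 2 μ := hL2 hfrm (hre1 hfb)
  have hfi2 : MemLp fi 2 μ := hL2 hfim (him1 hfb)
  have hgr2 : MemLp gr 2 μ := hL2 hgrm (hre1 hgb)
  have hgi2 : MemLp gi 2 μ := hL2 hgim (him1 hgb)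
  -- one-point functions vanish
  have hfint : Integrable f μ := Integrable.of_bound hfm.aestronglyMeasurable 1 (ae_of_all _ hfb)
  have hgint : Integrable g μ := Integrable.of_bound hgm.aestronglyMeasurable 1 (ae_of_all _ hgb)
  have hf0 : ∫ Q, f Q ∂μ = 0 := integral_entry_eq_zero hN β A B x a b
  have hg0 : ∫ Q, g Q ∂μ = 0 := integral_inv_entry_eq_zero hN β A B y c d
  have hfr0 : ∫ Q, fr Q ∂μ = 0 := by
    have := integral_re hfint; simp only [RCLike.re_to_complex, hf0, Complex.zero_re] at this; exact this
  have hfi0 : ∫ Q, fi Q ∂μ = 0 := by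
    have := integral_im hfint; simp only [RCLike.im_to_complex, hf0, Complex.zero_im] at this; exact this
  -- the product, split into real and imaginary parts
  have hprod : Integrable (fun Q => f Q * g Q) μ :=
    Integrable.of_bound (hfm.mul hgm).aestronglyMeasurable 1 (ae_of_all _ fun Q => by
      rw [norm_mul]; exact mul_le_one₀ (hfb Q) (norm_nonneg _) (hgb Q))
  have hre : (∫ Q, f Q * g Q ∂μ).re = cov[fr, gr; μ] - cov[fi, gi; μ] := by
    have h1 := integral_re hprod
    simp only [RCLike.re_to_complex, Complex.mul_re] at h1
    rw [← h1, integral_sub (hmul hfrm hgrm (hre1 hfb) (hre1 hgb)) (hmul hfim hgim (him1 hfb) (him1 hgb)),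
      covariance_eq_sub hfr2 hgr2,
      covariance_eq_sub hfi2 hgi2, hfr0, hfi0]
    simp only [zero_mul, sub_zero]
    rfl
  have him : (∫ Q, f Q * g Q ∂μ).im = cov[fr, gi; μ] + cov[fi, gr; μ] := by
    have h1 := integral_im hprod
    simp only [RCLike.im_to_complex, Complex.mul_im] at h1
    rw [← h1, integral_add (hmul hfrm hgim (hre1 hfb) (him1 hgb)) (hmul hfim hgrm (him1 hfb) (hre1 hgb)),
      covariance_eq_sub hfr2 hgi2,
      covariance_eq_sub hfi2 hgr2, hfr0, hfi0]
    simp only [zero_mul, sub_zero]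
    rfl
  -- the four covariance bounds
  have c1 := hcov x y a b c d Complex.re Complex.re (Or.inl rfl) (Or.inl rfl)
  have c2 := hcov x y a b c d Complex.im Complex.im (Or.inr rfl) (Or.inr rfl)
  have c3 := hcov x y a b c d Complex.re Complex.im (Or.inl rfl) (Or.inr rfl)
  have c4 := hcov x y a b c d Complex.im Complex.re (Or.inr rfl) (Or.inl rfl)
  calc ‖∫ Q, f Q * g Q ∂μ‖ ≤ |(∫ Q, f Q * g Q ∂μ).re| + |(∫ Q, f Q * g Q ∂μ).im| :=
        Complex.norm_le_abs_re_add_abs_im _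
    _ = |cov[fr, gr; μ] - cov[fi, gi; μ]| + |cov[fr, gi; μ] + cov[fi, gr; μ]| := by rw [hre, him]
    _ ≤ (|cov[fr, gr; μ]| + |cov[fi, gi; μ]|) + (|cov[fr, gi; μ]| + |cov[fi, gr; μ]|) :=
        add_le_add (abs_sub _ _) (abs_add_le _ _)
    _ ≤ (C₁ * Real.exp (-C₂ * torusGraphDist x y) + C₁ * Real.exp (-C₂ * torusGraphDist x y)) +
          (C₁ * Real.exp (-C₂ * torusGraphDist x y) + C₁ * Real.exp (-C₂ * torusGraphDist x y)) :=
        add_le_add (add_le_add c1 c2) (add_le_add c3 c4)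
    _ = 4 * C₁ * Real.exp (-C₂ * torusGraphDist x y) := by ring

end TwoPoint

/-! ### The induction on the vertical side (CNS §2: «products of T two point functions») -/

section Induction

variable {N : ℕ} [NeZero L]

attribute [local instance] secondCountable_SU

/-- The vertical link at height `t₀ + s` over the slice point `p`. [folklore] -/
def vlink (v : Fin (n + 1)) (t₀ : ZMod L) (p : Site n L) (s : ℕ) (U : GaugeConfig (n + 1) L (SU N)) : SU N :=
  U (ins v (t₀ + s) p, v)

/-- The vertical leg of `T` links upward from `ins v t₀ p`. [folklore] -/
def leg (v : Fin (n + 1)) (t₀ : ZMod L) (p : Site n L) : ℕ → GaugeConfig (n + 1) L (SU N) → SU N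
  | 0, _ => 1
  | T + 1, U => leg v t₀ p T U * vlink v t₀ p T U

omit [NeZero L] in
/-- The empty leg. [folklore] -/
@[simp] private theorem leg_zero (v : Fin (n + 1)) (t₀ : ZMod L) (p : Site n L) (U : GaugeConfig (n + 1) L (SU N)) :
    leg v t₀ p 0 U = 1 := rfl

omit [NeZero L] in
/-- One more link at the top of a leg. [folklore] -/
private theorem leg_succ (v : Fin (n + 1)) (t₀ : ZMod L) (p : Site n L) (T : ℕ) (U : GaugeConfig (n + 1) L (SU N)) :
    leg v t₀ p (T + 1) U = leg v t₀ p T U * vlink v t₀ p T U := rfl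

omit [NeZero L] in
/-- The leg is the tree's line holonomy in direction `v`. [folklore] -/
private theorem leg_eq_lineHolonomy (v : Fin (n + 1)) (t₀ : ZMod L) (p : Site n L) (T : ℕ)
    (U : GaugeConfig (n + 1) L (SU N)) : leg v t₀ p T U = lineHolonomy U v T (ins v t₀ p) := by
  induction T with
  | zero => rfl
  | succ T ih => rw [leg_succ, lineHolonomy_succ_right, ih, vlink, ins_add_single]

omit [NeZero L] in
/-- The leg is continuous in the configuration. [folklore] -/
private theorem continuous_leg (v : Fin (n + 1)) (t₀ : ZMod L) (p : Site n L) (T : ℕ) :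
    Continuous (leg (N := N) v t₀ p T) := by
  induction T with
  | zero => exact continuous_const
  | succ T ih => exact ih.mul (continuous_apply _)

omit [NeZero L] in
/-- The leg does not see the links off its own vertical line. [folklore] -/
private theorem leg_congr (v : Fin (n + 1)) (t₀ : ZMod L) (p : Site n L) {U U' : GaugeConfig (n + 1) L (SU N)} :
    ∀ T : ℕ, (∀ s : ℕ, s < T → U (ins v (t₀ + s) p, v) = U' (ins v (t₀ + s) p, v)) →
      leg v t₀ p T U = leg v t₀ p T U'
  | 0, _ => rfl
  | T + 1, h => by
      rw [leg_succ, leg_succ, leg_congr v t₀ p T fun s hs => h s (Nat.lt_succ_of_lt hs), vlink, vlink,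
        h T (Nat.lt_succ_self T)]

/-- A matrix-valued observable is HORIZONTAL if it does not depend on the links in direction `v`
(CNS §2: the «edges orthogonal to the vertical side», on which one conditions). [cite: CaoNissimSheffield2025dynamical, §2] -/
def IsHorizontal (v : Fin (n + 1)) (B : GaugeConfig (n + 1) L (SU N) → Matrix (Fin N) (Fin N) ℂ) : Prop :=
  ∀ U U' : GaugeConfig (n + 1) L (SU N), (∀ e : Edge (n + 1) L, e.2 ≠ v → U e = U' e) → B U = B U'

/-- The loop observable `tr(A · leg_T(p) · B · leg_T(p')^*)`. [folklore] -/
def loopObs (v : Fin (n + 1)) (t₀ : ZMod L) (p p' : Site n L) (T : ℕ)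
    (A B : GaugeConfig (n + 1) L (SU N) → Matrix (Fin N) (Fin N) ℂ) (U : GaugeConfig (n + 1) L (SU N)) : ℂ :=
  (A U * (leg v t₀ p T U : Matrix (Fin N) (Fin N) ℂ) * B U * star (leg v t₀ p' T U : Matrix (Fin N) (Fin N) ℂ)).trace

/-- `tr(M₁ M₂ M₃) = Σ_{a,b,c} (M₁)_{ab} (M₂)_{bc} (M₃)_{ca}`. [folklore] -/
private theorem trace_mul_mul_eq_sum (M₁ M₂ M₃ : Matrix (Fin N) (Fin N) ℂ) :
    (M₁ * M₂ * M₃).trace = ∑ τ : Fin N × Fin N × Fin N, M₁ τ.1 τ.2.1 * M₂ τ.2.1 τ.2.2 * M₃ τ.2.2 τ.1 := by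
  simp only [Matrix.trace, Matrix.diag, Matrix.mul_apply, Finset.sum_mul, Fintype.sum_prod_type]
  exact Finset.sum_congr rfl fun a _ => Finset.sum_comm

/-- Integrability of bounded measurable observables against the Wilson weight. [folklore] -/
private theorem integrable_weight_mul (β : ℝ) {F : GaugeConfig (n + 1) L (SU N) → ℂ} (hF : Measurable F) {C : ℝ}
    (hC : ∀ U, ‖F U‖ ≤ C) : Integrable (fun U => (weight N β U : ℂ) * F U) (linkMeasure n L N) := by
  obtain ⟨Cw, hCw⟩ := exists_weight_le (n := n) (L := L) (N := N) β
  refine Integrable.of_bound ?_ (Cw * C) (ae_of_all _ fun U => ?_)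
  · exact ((Complex.measurable_ofReal.comp (measurable_weight β)).mul hF).aestronglyMeasurable
  · rw [norm_mul, Complex.norm_real, Real.norm_eq_abs, abs_of_pos (weight_pos β _)]
    exact mul_le_mul (hCw _) (hC _) (norm_nonneg _) ((weight_pos β U).le.trans (hCw U))

omit [NeZero L] in
/-- Entries of a product of two entrywise-measurable matrix observables are measurable. [folklore] -/
private theorem measurable_mul_entry {M₁ M₂ : GaugeConfig (n + 1) L (SU N) → Matrix (Fin N) (Fin N) ℂ}
    (h₁ : ∀ a b, Measurable fun U => M₁ U a b) (h₂ : ∀ a b, Measurable fun U => M₂ U a b) (a b : Fin N) :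
    Measurable fun U => (M₁ U * M₂ U) a b := by
  simp only [Matrix.mul_apply]
  exact Finset.measurable_sum _ fun k _ => (h₁ a k).mul (h₂ k b)

/-- Entries of a product: `|(M₁M₂)_{ab}| ≤ N K₁ K₂`. [folklore] -/
private theorem norm_mul_entry_le {M₁ M₂ : Matrix (Fin N) (Fin N) ℂ} {K₁ K₂ : ℝ} (h₁ : ∀ a b, ‖M₁ a b‖ ≤ K₁)
    (h₂ : ∀ a b, ‖M₂ a b‖ ≤ K₂) (a b : Fin N) : ‖(M₁ * M₂) a b‖ ≤ N * (K₁ * K₂) := by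
  rw [Matrix.mul_apply]
  have hK₁ : 0 ≤ K₁ := (norm_nonneg _).trans (h₁ a a)
  calc ‖∑ k, M₁ a k * M₂ k b‖ ≤ ∑ k, ‖M₁ a k * M₂ k b‖ := norm_sum_le _ _
    _ ≤ ∑ _k : Fin N, K₁ * K₂ := Finset.sum_le_sum fun k _ => by
        rw [norm_mul]; exact mul_le_mul (h₁ a k) (h₂ k b) (norm_nonneg _) hK₁
    _ = N * (K₁ * K₂) := by simp

/-- Matrix entries of a leg are measurable. [folklore] -/
private theorem measurable_coe_leg_entry (v : Fin (n + 1)) (t₀ : ZMod L) (p : Site n L) (T : ℕ) (a b : Fin N) :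
    Measurable fun U : GaugeConfig (n + 1) L (SU N) => ((leg v t₀ p T U : SU N) : Matrix (Fin N) (Fin N) ℂ) a b :=
  ((continuous_subtype_val.comp (continuous_leg v t₀ p T)).matrix_elem a b).measurable

/-- Matrix entries of the adjoint of a leg are measurable. [folklore] -/
private theorem measurable_star_coe_leg_entry (v : Fin (n + 1)) (t₀ : ZMod L) (p : Site n L) (T : ℕ) (a b : Fin N) :
    Measurable fun U : GaugeConfig (n + 1) L (SU N) =>
      (star ((leg v t₀ p T U : SU N) : Matrix (Fin N) (Fin N) ℂ)) a b :=
  ((continuous_subtype_val.comp (continuous_leg v t₀ p T)).star.matrix_elem a b).measurable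

/-- Entries of the adjoint of an `SU(N)` matrix have norm `≤ 1`. [folklore] -/
private theorem norm_star_entry_le (g : SU N) (a b : Fin N) : ‖(star (g : Matrix (Fin N) (Fin N) ℂ)) a b‖ ≤ 1 := by
  rw [Matrix.star_apply, Complex.star_def, Complex.norm_conj]
  exact norm_entry_le g b a


omit [NeZero L] in
/-- `s ≠ T` in `ℤ/L` for `s < T < L`. [folklore] -/
private theorem natCast_ne_natCast_of_lt {s T : ℕ} (hs : s < T) (hT : T < L) : (s : ZMod L) ≠ (T : ZMod L) := by
  intro h
  rw [ZMod.natCast_eq_natCast_iff'] at h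
  rw [Nat.mod_eq_of_lt (hs.trans hT), Nat.mod_eq_of_lt hT] at h
  exact (ne_of_lt hs) h

omit [NeZero L] in
/-- The first `T` links of a leg are not vertical links of the slab at height `t₀ + T` (`T < L`). [folklore] -/
private theorem leg_glue (v : Fin (n + 1)) (t₀ : ZMod L) (p : Site n L) {T : ℕ} (hT : T < L)
    (Q : Site n L → SU N) (r : {e : Edge (n + 1) L // ¬ IsSlab v (t₀ + (T : ZMod L)) e} → SU N) :
    leg v t₀ p T (glue v (t₀ + (T : ZMod L)) Q r) = leg v t₀ p T (glue v (t₀ + (T : ZMod L)) (fun _ => 1) r) := by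
  refine leg_congr v t₀ p T fun s hs => ?_
  have hns : ¬ IsSlab v (t₀ + (T : ZMod L)) (ins v (t₀ + (s : ZMod L)) p, v) := by
    rintro ⟨-, h⟩
    have h' : t₀ + (s : ZMod L) = t₀ + (T : ZMod L) := by simpa using h
    exact natCast_ne_natCast_of_lt hs hT (add_left_cancel h')
  rw [glue_of_not_isSlab _ _ _ _ hns, glue_of_not_isSlab _ _ _ _ hns]

/-- The factor of the loop observable that does NOT see the top slab: `(A·leg_T(p))_{ab} (leg_T(p')^*)_{ca}`. [folklore] -/
def legFactor (v : Fin (n + 1)) (t₀ : ZMod L) (p p' : Site n L) (T : ℕ)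
    (A : GaugeConfig (n + 1) L (SU N) → Matrix (Fin N) (Fin N) ℂ) (τ : Fin N × Fin N × Fin N)
    (U : GaugeConfig (n + 1) L (SU N)) : ℂ :=
  (A U * (leg v t₀ p T U : Matrix (Fin N) (Fin N) ℂ)) τ.1 τ.2.1 *
    (star ((leg v t₀ p' T U : SU N) : Matrix (Fin N) (Fin N) ℂ)) τ.2.2 τ.1

/-- The factor of the loop observable living in the top slab: `(Q_p B Q_{p'}^*)_{bc}`. [folklore] -/
def slabFactor (v : Fin (n + 1)) (t₀ : ZMod L) (p p' : Site n L) (T : ℕ)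
    (B : GaugeConfig (n + 1) L (SU N) → Matrix (Fin N) (Fin N) ℂ) (bc : Fin N × Fin N)
    (U : GaugeConfig (n + 1) L (SU N)) : ℂ :=
  (((vlink v t₀ p T U : SU N) : Matrix (Fin N) (Fin N) ℂ) * B U *
    star ((vlink v t₀ p' T U : SU N) : Matrix (Fin N) (Fin N) ℂ)) bc.1 bc.2

omit [NeZero L] in
/-- The loop observable with one more slab, regrouped around the top slab. [folklore] -/
private theorem loopObs_succ (v : Fin (n + 1)) (t₀ : ZMod L) (p p' : Site n L) (T : ℕ)
    (A B : GaugeConfig (n + 1) L (SU N) → Matrix (Fin N) (Fin N) ℂ) (U : GaugeConfig (n + 1) L (SU N)) :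
    loopObs v t₀ p p' (T + 1) A B U =
      ∑ τ : Fin N × Fin N × Fin N, legFactor v t₀ p p' T A τ U * slabFactor v t₀ p p' T B (τ.2.1, τ.2.2) U := by
  rw [loopObs, leg_succ, leg_succ, Submonoid.coe_mul, Submonoid.coe_mul, star_mul]
  have : A U * ((leg v t₀ p T U : Matrix (Fin N) (Fin N) ℂ) * (vlink v t₀ p T U : Matrix (Fin N) (Fin N) ℂ)) *
      B U * (star ((vlink v t₀ p' T U : SU N) : Matrix (Fin N) (Fin N) ℂ) *
        star ((leg v t₀ p' T U : SU N) : Matrix (Fin N) (Fin N) ℂ)) =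
      (A U * (leg v t₀ p T U : Matrix (Fin N) (Fin N) ℂ)) *
        ((vlink v t₀ p T U : Matrix (Fin N) (Fin N) ℂ) * B U * star ((vlink v t₀ p' T U : SU N) : Matrix (Fin N) (Fin N) ℂ)) *
        star ((leg v t₀ p' T U : SU N) : Matrix (Fin N) (Fin N) ℂ) := by
    simp only [mul_assoc]
  rw [this, trace_mul_mul_eq_sum]
  exact Finset.sum_congr rfl fun τ _ => by simp only [legFactor, slabFactor]; ring

omit [NeZero L] in
/-- The loop observable expanded around `B`. [folklore] -/
private theorem loopObs_eq_sum (v : Fin (n + 1)) (t₀ : ZMod L) (p p' : Site n L) (T : ℕ)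
    (A B : GaugeConfig (n + 1) L (SU N) → Matrix (Fin N) (Fin N) ℂ) (U : GaugeConfig (n + 1) L (SU N)) :
    loopObs v t₀ p p' T A B U =
      ∑ τ : Fin N × Fin N × Fin N, legFactor v t₀ p p' T A τ U * B U τ.2.1 τ.2.2 := by
  rw [loopObs, trace_mul_mul_eq_sum]
  exact Finset.sum_congr rfl fun τ _ => by simp only [legFactor]; ring

/-- The slab-averaged `B`: `B̃(U)_{bc} = E_{slab t₀+T}[(Q_p B(U) Q_{p'}^*)_{bc}]`. [folklore] -/
def peelB (v : Fin (n + 1)) (t₀ : ZMod L) (p p' : Site n L) (T : ℕ) (β : ℝ)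
    (B : GaugeConfig (n + 1) L (SU N) → Matrix (Fin N) (Fin N) ℂ) (U : GaugeConfig (n + 1) L (SU N)) :
    Matrix (Fin N) (Fin N) ℂ :=
  Matrix.of fun b c => slabAvg v (t₀ + (T : ZMod L)) β (slabFactor v t₀ p p' T B (b, c))
    (restPart v (t₀ + (T : ZMod L)) U)

/-- Entries of the slab-averaged `B`. [folklore] -/
private theorem peelB_apply (v : Fin (n + 1)) (t₀ : ZMod L) (p p' : Site n L) (T : ℕ) (β : ℝ)
    (B : GaugeConfig (n + 1) L (SU N) → Matrix (Fin N) (Fin N) ℂ) (U : GaugeConfig (n + 1) L (SU N)) (b c : Fin N) :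
    peelB v t₀ p p' T β B U b c =
      slabAvg v (t₀ + (T : ZMod L)) β (slabFactor v t₀ p p' T B (b, c)) (restPart v (t₀ + (T : ZMod L)) U) := by
  simp only [peelB, Matrix.of_apply]

omit [NeZero L] in
/-- The vertical link of a glued configuration is the slab spin. [folklore] -/
private theorem vlink_glue (v : Fin (n + 1)) (t₀ : ZMod L) (p : Site n L) (T : ℕ) (Q : Site n L → SU N)
    (r : {e : Edge (n + 1) L // ¬ IsSlab v (t₀ + (T : ZMod L)) e} → SU N) :
    vlink v t₀ p T (glue v (t₀ + (T : ZMod L)) Q r) = Q p := by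
  rw [vlink, glue_ins]

/-- Matrix entries of a vertical link are measurable. [folklore] -/
private theorem measurable_vlink_entry (v : Fin (n + 1)) (t₀ : ZMod L) (p : Site n L) (T : ℕ) (a b : Fin N) :
    Measurable fun U : GaugeConfig (n + 1) L (SU N) => ((vlink v t₀ p T U : SU N) : Matrix (Fin N) (Fin N) ℂ) a b :=
  ((continuous_subtype_val.comp (continuous_apply _)).matrix_elem a b).measurable

/-- Matrix entries of the adjoint of a vertical link are measurable. [folklore] -/
private theorem measurable_star_vlink_entry (v : Fin (n + 1)) (t₀ : ZMod L) (p : Site n L) (T : ℕ) (a b : Fin N) :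
    Measurable fun U : GaugeConfig (n + 1) L (SU N) =>
      (star ((vlink v t₀ p T U : SU N) : Matrix (Fin N) (Fin N) ℂ)) a b :=
  ((continuous_subtype_val.comp (continuous_apply _)).star.matrix_elem a b).measurable

/-- The leg factor is measurable. [folklore] -/
private theorem measurable_legFactor (v : Fin (n + 1)) (t₀ : ZMod L) (p p' : Site n L) (T : ℕ)
    {A : GaugeConfig (n + 1) L (SU N) → Matrix (Fin N) (Fin N) ℂ} (hAm : ∀ a b, Measurable fun U => A U a b)
    (τ : Fin N × Fin N × Fin N) : Measurable (legFactor v t₀ p p' T A τ) :=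
  (measurable_mul_entry hAm (measurable_coe_leg_entry v t₀ p T) τ.1 τ.2.1).mul
    (measurable_star_coe_leg_entry v t₀ p' T τ.2.2 τ.1)

omit [NeZero L] in
/-- The leg factor is bounded by `N`. [folklore] -/
private theorem norm_legFactor_le (v : Fin (n + 1)) (t₀ : ZMod L) (p p' : Site n L) (T : ℕ)
    {A : GaugeConfig (n + 1) L (SU N) → Matrix (Fin N) (Fin N) ℂ} (hA : ∀ U a b, ‖A U a b‖ ≤ 1)
    (τ : Fin N × Fin N × Fin N) (U : GaugeConfig (n + 1) L (SU N)) : ‖legFactor v t₀ p p' T A τ U‖ ≤ N := by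
  rw [legFactor, norm_mul]
  have h1 := norm_mul_entry_le (hA U) (fun a b => norm_entry_le (leg v t₀ p T U) a b) τ.1 τ.2.1
  have h2 := norm_star_entry_le (leg v t₀ p' T U) τ.2.2 τ.1
  calc _ ≤ (N : ℝ) * (1 * 1) * 1 := mul_le_mul h1 h2 (norm_nonneg _) (by positivity)
    _ = N := by ring

/-- The slab factor is measurable. [folklore] -/
private theorem measurable_slabFactor (v : Fin (n + 1)) (t₀ : ZMod L) (p p' : Site n L) (T : ℕ)
    {B : GaugeConfig (n + 1) L (SU N) → Matrix (Fin N) (Fin N) ℂ} (hBm : ∀ a b, Measurable fun U => B U a b)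
    (bc : Fin N × Fin N) : Measurable (slabFactor v t₀ p p' T B bc) :=
  measurable_mul_entry (measurable_mul_entry (measurable_vlink_entry v t₀ p T) hBm)
    (measurable_star_vlink_entry v t₀ p' T) bc.1 bc.2

omit [NeZero L] in
/-- The slab factor is bounded by `N²K`. [folklore] -/
private theorem norm_slabFactor_le (v : Fin (n + 1)) (t₀ : ZMod L) (p p' : Site n L) (T : ℕ)
    {B : GaugeConfig (n + 1) L (SU N) → Matrix (Fin N) (Fin N) ℂ} {K : ℝ} (hB : ∀ U a b, ‖B U a b‖ ≤ K)
    (bc : Fin N × Fin N) (U : GaugeConfig (n + 1) L (SU N)) :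
    ‖slabFactor v t₀ p p' T B bc U‖ ≤ (N : ℝ) * ((N : ℝ) * (1 * K) * 1) :=
  norm_mul_entry_le (norm_mul_entry_le (fun a b => norm_entry_le _ a b) (hB U))
    (fun a b => norm_star_entry_le _ a b) bc.1 bc.2

/-- **The induction** (CNS §2, «the terms … break down into products of `T` two point correlation
functions»): if every slab two-point function `E[(Q_p)_{ab}(Q_{p'}⁻¹)_{cd}]` is bounded by `ε`,
then `|∫ e^{-NβS} tr(A·leg_T(p)·B·leg_T(p')^*)| ≤ N² K (N² ε)^T ∫ e^{-NβS}` for horizontal `A, B` with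
entries bounded by `1` and `K`. [cite: CaoNissimSheffield2025dynamical, §2] -/
theorem norm_integral_loopObs_le (v : Fin (n + 1)) (t₀ : ZMod L) (p p' : Site n L) (β : ℝ)
    {ε : ℝ} (hε0 : 0 ≤ ε)
    (hε : ∀ (s : ℕ) (r : {e : Edge (n + 1) L // ¬ IsSlab v (t₀ + (s : ZMod L)) e} → SU N) (a b c d : Fin N),
      ‖∫ Q, ((Q p : SU N) : Matrix (Fin N) (Fin N) ℂ) a b * (((Q p')⁻¹ : SU N) : Matrix (Fin N) (Fin N) ℂ) c d
        ∂(slabLaw v (t₀ + (s : ZMod L)) β r)‖ ≤ ε) :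
    ∀ (T : ℕ), T ≤ L → ∀ (K : ℝ), 0 ≤ K → ∀ (A B : GaugeConfig (n + 1) L (SU N) → Matrix (Fin N) (Fin N) ℂ),
      (∀ a b, Measurable fun U => A U a b) → (∀ a b, Measurable fun U => B U a b) →
      (∀ U a b, ‖A U a b‖ ≤ 1) → (∀ U a b, ‖B U a b‖ ≤ K) → IsHorizontal v A → IsHorizontal v B →
      ‖∫ U, (weight N β U : ℂ) * loopObs v t₀ p p' T A B U ∂(linkMeasure n L N)‖ ≤
        (N : ℝ) ^ 2 * K * ((N : ℝ) ^ 2 * ε) ^ T * ∫ U, weight N β U ∂(linkMeasure n L N) := by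
  intro T
  induction T with
  | zero =>
    intro _ K hK A B hAm hBm hA hB _ _
    rw [pow_zero, mul_one]
    have hbound : ∀ U, ‖loopObs v t₀ p p' 0 A B U‖ ≤ (N : ℝ) ^ 2 * K := by
      intro U
      simp only [loopObs, leg_zero, Submonoid.coe_one, star_one, mul_one]
      rw [Matrix.trace]
      calc ‖∑ a, (A U * B U) a a‖ ≤ ∑ a, ‖(A U * B U) a a‖ := norm_sum_le _ _
        _ ≤ ∑ _a : Fin N, (N : ℝ) * (1 * K) := Finset.sum_le_sum fun a _ => norm_mul_entry_le (hA U) (hB U) a a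
        _ = (N : ℝ) ^ 2 * K := by simp; ring
    have hm : Measurable (loopObs v t₀ p p' 0 A B) := by
      have : loopObs v t₀ p p' 0 A B = fun U => ∑ τ : Fin N × Fin N × Fin N,
          legFactor v t₀ p p' 0 A τ U * B U τ.2.1 τ.2.2 := funext fun U => loopObs_eq_sum v t₀ p p' 0 A B U
      rw [this]
      exact Finset.measurable_sum _ fun τ _ => (measurable_legFactor v t₀ p p' 0 hAm τ).mul (hBm _ _)
    calc ‖∫ U, (weight N β U : ℂ) * loopObs v t₀ p p' 0 A B U ∂(linkMeasure n L N)‖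
        ≤ ∫ U, ‖(weight N β U : ℂ) * loopObs v t₀ p p' 0 A B U‖ ∂(linkMeasure n L N) :=
          norm_integral_le_integral_norm _
      _ ≤ ∫ U, weight N β U * ((N : ℝ) ^ 2 * K) ∂(linkMeasure n L N) := by
          refine integral_mono (integrable_weight_mul β hm hbound).norm ?_ fun U => ?_
          · exact (integrable_exp_mul_wilsonAction (fundamentalRep (Fin N)) (continuous_fundamentalRep (Fin N))
              _ _).mul_const _
          · rw [norm_mul, Complex.norm_real, Real.norm_eq_abs, abs_of_pos (weight_pos β U)]
            exact mul_le_mul_of_nonneg_left (hbound U) (weight_pos β U).le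
      _ = (N : ℝ) ^ 2 * K * ∫ U, weight N β U ∂(linkMeasure n L N) := by
          rw [integral_mul_const, mul_comm]
  | succ T ih =>
    intro hTL K hK A B hAm hBm hA hB hAh hBh
    have hT : T < L := Nat.lt_of_succ_le hTL
    have hGslab : ∀ τ Q r, legFactor v t₀ p p' T A τ (glue v (t₀ + (T : ZMod L)) Q r) =
        legFactor v t₀ p p' T A τ (glue v (t₀ + (T : ZMod L)) (fun _ => 1) r) := by
      intro τ Q r
      simp only [legFactor]
      rw [leg_glue v t₀ p hT, leg_glue v t₀ p' hT,
        hAh (glue v (t₀ + (T : ZMod L)) Q r) (glue v (t₀ + (T : ZMod L)) (fun _ => 1) r) fun e he => ?_]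
      have hns : ¬ IsSlab v (t₀ + (T : ZMod L)) e := fun h => he h.1
      rw [glue_of_not_isSlab _ _ _ _ hns, glue_of_not_isSlab _ _ _ _ hns]
    -- Step 1: expand, peel the top slab in every term, recombine
    have hstep : ∫ U, (weight N β U : ℂ) * loopObs v t₀ p p' (T + 1) A B U ∂(linkMeasure n L N) =
        ∫ U, (weight N β U : ℂ) * loopObs v t₀ p p' T A (peelB v t₀ p p' T β B) U ∂(linkMeasure n L N) := by
      have e1 : (fun U => (weight N β U : ℂ) * loopObs v t₀ p p' (T + 1) A B U) = fun U =>
          ∑ τ : Fin N × Fin N × Fin N, (weight N β U : ℂ) *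
            (legFactor v t₀ p p' T A τ U * slabFactor v t₀ p p' T B (τ.2.1, τ.2.2) U) := by
        funext U; rw [loopObs_succ, Finset.mul_sum]
      have e2 : (fun U => (weight N β U : ℂ) * loopObs v t₀ p p' T A (peelB v t₀ p p' T β B) U) = fun U =>
          ∑ τ : Fin N × Fin N × Fin N, (weight N β U : ℂ) *
            (legFactor v t₀ p p' T A τ U * slabAvg v (t₀ + (T : ZMod L)) β
              (slabFactor v t₀ p p' T B (τ.2.1, τ.2.2)) (restPart v (t₀ + (T : ZMod L)) U)) := by
        funext U; rw [loopObs_eq_sum, Finset.mul_sum]; simp only [peelB_apply]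
      have i1 : ∀ τ : Fin N × Fin N × Fin N, Integrable (fun U => (weight N β U : ℂ) *
          (legFactor v t₀ p p' T A τ U * slabFactor v t₀ p p' T B (τ.2.1, τ.2.2) U)) (linkMeasure n L N) :=
        fun τ => integrable_weight_mul β ((measurable_legFactor v t₀ p p' T hAm τ).mul
          (measurable_slabFactor v t₀ p p' T hBm _)) fun U => by
          rw [norm_mul]
          exact mul_le_mul (norm_legFactor_le v t₀ p p' T hA τ U) (norm_slabFactor_le v t₀ p p' T hB _ U)
            (norm_nonneg _) (Nat.cast_nonneg _)
      have i2 : ∀ τ : Fin N × Fin N × Fin N, Integrable (fun U => (weight N β U : ℂ) *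
          (legFactor v t₀ p p' T A τ U * slabAvg v (t₀ + (T : ZMod L)) β
            (slabFactor v t₀ p p' T B (τ.2.1, τ.2.2)) (restPart v (t₀ + (T : ZMod L)) U))) (linkMeasure n L N) :=
        fun τ => integrable_weight_mul β ((measurable_legFactor v t₀ p p' T hAm τ).mul
          ((measurable_slabAvg v _ β (measurable_slabFactor v t₀ p p' T hBm _)).comp
            (measurable_restPart v _))) fun U => by
          rw [norm_mul]
          exact mul_le_mul (norm_legFactor_le v t₀ p p' T hA τ U)
            (norm_slabAvg_le v _ β (norm_slabFactor_le v t₀ p p' T hB _) _) (norm_nonneg _) (Nat.cast_nonneg _)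
      rw [e1, e2, integral_finsetSum _ fun τ _ => i1 τ, integral_finsetSum _ fun τ _ => i2 τ]
      exact Finset.sum_congr rfl fun τ _ =>
        integral_weight_mul_mul_eq_slabAvg v (t₀ + (T : ZMod L)) β (legFactor v t₀ p p' T A τ)
          (slabFactor v t₀ p p' T B (τ.2.1, τ.2.2)) (measurable_legFactor v t₀ p p' T hAm τ)
          (measurable_slabFactor v t₀ p p' T hBm _) N _ (norm_legFactor_le v t₀ p p' T hA τ)
          (norm_slabFactor_le v t₀ p p' T hB _) (hGslab τ)
    -- Step 2: the new `B` is measurable, smaller by `N² ε`, and horizontal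
    have hB'm : ∀ a b, Measurable fun U => peelB v t₀ p p' T β B U a b := fun a b => by
      simp only [peelB_apply]
      exact (measurable_slabAvg v _ β (measurable_slabFactor v t₀ p p' T hBm (a, b))).comp
        (measurable_restPart v _)
    have hB'b : ∀ U a b, ‖peelB v t₀ p p' T β B U a b‖ ≤ (N : ℝ) ^ 2 * ε * K := by
      intro U b c
      rw [peelB_apply, slabAvg]
      set r := restPart v (t₀ + (T : ZMod L)) U with hr
      -- `B` is constant on the slab
      have hBc : ∀ Q, B (glue v (t₀ + (T : ZMod L)) Q r) = B (glue v (t₀ + (T : ZMod L)) (fun _ => 1) r) :=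
        fun Q => hBh _ _ fun e he => by
          have hns : ¬ IsSlab v (t₀ + (T : ZMod L)) e := fun h => he h.1
          rw [glue_of_not_isSlab _ _ _ _ hns, glue_of_not_isSlab _ _ _ _ hns]
      set B₀ := B (glue v (t₀ + (T : ZMod L)) (fun _ => 1) r) with hB₀
      have hint : ∀ Q, slabFactor v t₀ p p' T B (b, c) (glue v (t₀ + (T : ZMod L)) Q r) =
          ∑ κ : Fin N × Fin N, B₀ κ.1 κ.2 * (((Q p : SU N) : Matrix (Fin N) (Fin N) ℂ) b κ.1 *
            (((Q p')⁻¹ : SU N) : Matrix (Fin N) (Fin N) ℂ) κ.2 c) := by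
        intro Q
        rw [slabFactor, vlink_glue, vlink_glue, hBc Q, ← coe_inv_SU]
        simp only [Matrix.mul_apply, Finset.sum_mul, Fintype.sum_prod_type]
        rw [Finset.sum_comm]
        exact Finset.sum_congr rfl fun κ₁ _ => Finset.sum_congr rfl fun κ₂ _ => by ring
      simp_rw [hint]
      rw [integral_finsetSum _ fun κ _ => ?_]
      · calc ‖∑ κ : Fin N × Fin N, ∫ Q, B₀ κ.1 κ.2 * (((Q p : SU N) : Matrix (Fin N) (Fin N) ℂ) b κ.1 *
              (((Q p')⁻¹ : SU N) : Matrix (Fin N) (Fin N) ℂ) κ.2 c) ∂(slabLaw v (t₀ + (T : ZMod L)) β r)‖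
            ≤ ∑ κ : Fin N × Fin N, ‖∫ Q, B₀ κ.1 κ.2 * (((Q p : SU N) : Matrix (Fin N) (Fin N) ℂ) b κ.1 *
              (((Q p')⁻¹ : SU N) : Matrix (Fin N) (Fin N) ℂ) κ.2 c) ∂(slabLaw v (t₀ + (T : ZMod L)) β r)‖ :=
              norm_sum_le _ _
          _ ≤ ∑ _κ : Fin N × Fin N, K * ε := Finset.sum_le_sum fun κ _ => by
              rw [integral_const_mul, norm_mul]
              exact mul_le_mul (hB _ _ _) (hε T r b κ.1 κ.2 c) (norm_nonneg _) hK
          _ = (N : ℝ) ^ 2 * ε * K := by simp; ring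
      · refine Integrable.of_bound ?_ (K * (1 * 1)) (ae_of_all _ fun Q => ?_)
        · exact (measurable_const.mul ((measurable_entry p b κ.1).mul
            (measurable_inv_entry p' κ.2 c))).aestronglyMeasurable
        · rw [norm_mul, norm_mul]
          exact mul_le_mul (hB _ _ _) (mul_le_mul (norm_entry_le _ _ _) (norm_entry_le _ _ _) (norm_nonneg _)
            zero_le_one) (by positivity) hK
    have hB'h : IsHorizontal v (peelB v t₀ p p' T β B) := by
      intro U U' hUU'
      ext b c
      rw [peelB_apply, peelB_apply, slabAvg, slabAvg]
      have hrest : ∀ Q (e : Edge (n + 1) L), e.2 ≠ v →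
          glue v (t₀ + (T : ZMod L)) Q (restPart v (t₀ + (T : ZMod L)) U) e =
            glue v (t₀ + (T : ZMod L)) Q (restPart v (t₀ + (T : ZMod L)) U') e := by
        intro Q e he
        have hns : ¬ IsSlab v (t₀ + (T : ZMod L)) e := fun h => he h.1
        rw [glue_of_not_isSlab _ _ _ _ hns, glue_of_not_isSlab _ _ _ _ hns]
        exact hUU' e he
      have hlaw : slabLaw v (t₀ + (T : ZMod L)) β (restPart v (t₀ + (T : ZMod L)) U) =
          slabLaw v (t₀ + (T : ZMod L)) β (restPart v (t₀ + (T : ZMod L)) U') := by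
        simp only [slabLaw]
        congr 1
        · funext e; simp only [topField]; rw [hrest _ _ (Fin.succAbove_ne v e.2)]
        · funext e; simp only [botField]; rw [hrest _ _ (Fin.succAbove_ne v e.2)]
      rw [hlaw]
      refine integral_congr_ae (ae_of_all _ fun Q => ?_)
      simp only [slabFactor, vlink_glue]
      rw [hBh _ _ (hrest Q)]
    -- Step 3: the induction hypothesis
    rw [hstep]
    calc _ ≤ (N : ℝ) ^ 2 * ((N : ℝ) ^ 2 * ε * K) * ((N : ℝ) ^ 2 * ε) ^ T *
          ∫ U, weight N β U ∂(linkMeasure n L N) :=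
          ih hT.le _ (by positivity) A _ hAm hB'm hA hB'b hAh hB'h
      _ = (N : ℝ) ^ 2 * K * ((N : ℝ) ^ 2 * ε) ^ (T + 1) * ∫ U, weight N β U ∂(linkMeasure n L N) := by ring

end Induction


/-! ### Assembly: the Wilson loop as a loop observable, and the area law -/

section Assembly

variable {N : ℕ} [NeZero L]

attribute [local instance] secondCountable_SU

open ProbabilityTheory

omit [NeZero L] in
/-- `rectangle(j,i,T,R) = rectangle(i,j,R,T)⁻¹`: the same loop traversed backwards. [folklore] -/
private theorem rectangleHolonomy_swap {G : Type*} [Group G] {d : ℕ} (U : GaugeConfig d L G) (x : Site d L)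
    (i j : Fin d) (R T : ℕ) :
    rectangleHolonomy U x j i T R = (rectangleHolonomy U x i j R T)⁻¹ := by
  simp only [rectangleHolonomy, mul_inv_rev, inv_inv, mul_assoc]

omit [NeZero L] in
/-- The Wilson loop observable does not depend on the orientation of the rectangle (the loop
traversed backwards; `Re tr g⁻¹ = Re tr g`). [cite: Wilson1974] -/
theorem wilsonLoop_swap {d : ℕ} (U : GaugeConfig d L (SU N)) (x : Site d L) (i j : Fin d) (R T : ℕ) :
    wilsonLoop (fundamentalRep (Fin N)) x j i T R U = wilsonLoop (fundamentalRep (Fin N)) x i j R T U := by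
  rw [wilsonLoop, wilsonLoop, rectangleHolonomy_swap, fundamentalRep_apply, fundamentalRep_apply, coe_inv_SU,
    trace_star_re]

omit [NeZero L] in
/-- `|W_γ(U)| ≤ 1`. [folklore] -/
private theorem abs_wilsonLoop_le_one {d : ℕ} (U : GaugeConfig d L (SU N)) (x : Site d L) (i j : Fin d) (R T : ℕ) :
    |wilsonLoop (fundamentalRep (Fin N)) x i j R T U| ≤ 1 := by
  rw [wilsonLoop, fundamentalRep_apply, abs_mul]
  rcases Nat.eq_zero_or_pos N with hN | hN
  · subst hN; simp
  · have hNr : (0 : ℝ) < N := by exact_mod_cast hN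
    rw [abs_inv, Nat.abs_cast, inv_mul_le_iff₀ hNr, mul_one]
    set M := ((rectangleHolonomy U x i j R T : SU N) : Matrix (Fin N) (Fin N) ℂ)
    calc |(M.trace).re| ≤ ‖M.trace‖ := Complex.abs_re_le_norm _
      _ = ‖∑ a, M a a‖ := by rw [Matrix.trace]; rfl
      _ ≤ ∑ a, ‖M a a‖ := norm_sum_le _ _
      _ ≤ ∑ _a : Fin N, (1 : ℝ) := Finset.sum_le_sum fun a _ => norm_entry_le _ a a
      _ = N := by simp

/-- `|⟨W_γ⟩| ≤ 1` (`|W_γ| ≤ 1` pointwise). [cite: Wilson1974] -/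
theorem abs_wilsonExpectation_wilsonLoop_le_one {d : ℕ} (β : ℝ) (x : Site d L) (i j : Fin d) (R T : ℕ) :
    |wilsonExpectation (fundamentalRep (Fin N)) β (wilsonLoop (d := d) (L := L) (fundamentalRep (Fin N)) x i j R T)| ≤ 1 := by
  haveI := isProbabilityMeasure_wilsonMeasure (d := d) (L := L) (fundamentalRep (Fin N))
    (continuous_fundamentalRep (Fin N)) β
  have h := norm_integral_le_of_norm_le_const (μ := wilsonMeasure (fundamentalRep (Fin N)) β)
    (f := wilsonLoop (d := d) (L := L) (fundamentalRep (Fin N)) x i j R T) (C := 1)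
    (ae_of_all _ fun U => by rw [Real.norm_eq_abs]; exact abs_wilsonLoop_le_one U x i j R T)
  simpa [wilsonExpectation] using h

/-- The slice distance between the two legs: `d(x̄ + R e_k, x̄) = R` for `2R ≤ L`. [folklore] -/
private theorem torusGraphDist_add_single (x : Site n L) (k : Fin n) {R : ℕ} (hR : 2 * R ≤ L) :
    torusGraphDist (x + Pi.single k (R : ZMod L)) x = R := by
  unfold torusGraphDist
  have hL : 0 < L := Nat.pos_of_ne_zero (NeZero.ne L)
  have hval : ((R : ℕ) : ZMod L).valMinAbs = R :=
    ZMod.valMinAbs_natCast_of_le_half (by omega)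
  rw [Finset.sum_eq_single k]
  · simp [hval]
  · intro k' _ hk'
    simp [hk']
  · intro h; exact absurd (Finset.mem_univ k) h

omit [NeZero L] in
/-- A line holonomy in direction `i` is horizontal for every `v ≠ i`. [folklore] -/
private theorem isHorizontal_leg {v i : Fin (n + 1)} (hvi : i ≠ v) (t : ZMod L) (q : Site n L) (R : ℕ) :
    IsHorizontal (N := N) v fun U => ((leg i t q R U : SU N) : Matrix (Fin N) (Fin N) ℂ) := by
  intro U U' h
  show ((leg i t q R U : SU N) : Matrix (Fin N) (Fin N) ℂ) = ((leg i t q R U' : SU N) : Matrix (Fin N) (Fin N) ℂ)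
  rw [leg_congr i t q R fun s _ => h _ hvi]

omit [NeZero L] in
/-- The adjoint of a line holonomy in direction `i` is horizontal for every `v ≠ i`. [folklore] -/
private theorem isHorizontal_star_leg {v i : Fin (n + 1)} (hvi : i ≠ v) (t : ZMod L) (q : Site n L) (R : ℕ) :
    IsHorizontal (N := N) v fun U => star ((leg i t q R U : SU N) : Matrix (Fin N) (Fin N) ℂ) := by
  intro U U' h
  show star ((leg i t q R U : SU N) : Matrix (Fin N) (Fin N) ℂ) =
    star ((leg i t q R U' : SU N) : Matrix (Fin N) (Fin N) ℂ)
  rw [leg_congr i t q R fun s _ => h _ hvi]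

omit [NeZero L] in
/-- **The Wilson loop is a loop observable**: with `v = j`, `t₀ = x_j`, legs over `p = x̄ + R e_ī`
and `p' = x̄`, `A = P(x → x + R e_i)`, `B = P(x + T e_j → x + R e_i + T e_j)^*` (CNS §2: «we condition
on all the values of `Q_e` orthogonal to the length-`T` side»). [cite: CaoNissimSheffield2025dynamical, §2] -/
theorem wilsonLoop_eq_loopObs (x : Site (n + 1) L) {i j : Fin (n + 1)} {ī : Fin n} (hī : j.succAbove ī = i)
    (R T : ℕ) (U : GaugeConfig (n + 1) L (SU N)) :
    wilsonLoop (fundamentalRep (Fin N)) x i j R T U =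
      (N : ℝ)⁻¹ * (loopObs j (x j) (rem j x + Pi.single ī (R : ZMod L)) (rem j x) T
        (fun U => ((leg i (x i) (rem i x) R U : SU N) : Matrix (Fin N) (Fin N) ℂ))
        (fun U => star ((leg i ((x + Pi.single j ((T : ℕ) : ZMod L) : Site (n + 1) L) i)
          (rem i (x + Pi.single j ((T : ℕ) : ZMod L))) R U : SU N) : Matrix (Fin N) (Fin N) ℂ)) U).re := by
  have h1 : lineHolonomy U i R x = leg i (x i) (rem i x) R U := by
    rw [leg_eq_lineHolonomy, ins_rem]
  have h2 : lineHolonomy U j T (x + Pi.single i ((R : ℕ) : ZMod L)) =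
      leg j (x j) (rem j x + Pi.single ī (R : ZMod L)) T U := by
    rw [leg_eq_lineHolonomy, ← ins_add_single_succAbove, hī, ins_rem]
  have h3 : lineHolonomy U i R (x + Pi.single j ((T : ℕ) : ZMod L)) =
      leg i ((x + Pi.single j ((T : ℕ) : ZMod L) : Site (n + 1) L) i) (rem i (x + Pi.single j ((T : ℕ) : ZMod L))) R U := by
    rw [leg_eq_lineHolonomy, ins_rem]
  have h4 : lineHolonomy U j T x = leg j (x j) (rem j x) T U := by
    rw [leg_eq_lineHolonomy, ins_rem]
  have hM : ((rectangleHolonomy U x i j R T : SU N) : Matrix (Fin N) (Fin N) ℂ) =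
      ((leg i (x i) (rem i x) R U : SU N) : Matrix (Fin N) (Fin N) ℂ) *
        ((leg j (x j) (rem j x + Pi.single ī (R : ZMod L)) T U : SU N) : Matrix (Fin N) (Fin N) ℂ) *
        star ((leg i ((x + Pi.single j ((T : ℕ) : ZMod L) : Site (n + 1) L) i)
          (rem i (x + Pi.single j ((T : ℕ) : ZMod L))) R U : SU N) : Matrix (Fin N) (Fin N) ℂ) *
        star ((leg j (x j) (rem j x) T U : SU N) : Matrix (Fin N) (Fin N) ℂ) := by
    rw [rectangleHolonomy, h1, h2, h3, h4]
    simp only [Submonoid.coe_mul, coe_inv_SU]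
  rw [wilsonLoop, fundamentalRep_apply]
  simp only [loopObs]
  rw [hM]

/-- **The main bound** (CNS §2, eq. before (area-law-intermediate), sharpened): for every loop with
vertical side `T ≤ L` and horizontal separation `R`, `2R ≤ L`,
`|⟨W_{R×T}⟩| ≤ N (4N²C₁ e^{-C₂R})^T`. [cite: CaoNissimSheffield2025dynamical, Theorem 2.3] -/
theorem abs_wilsonExpectation_le_pow (hN : 2 ≤ N) (β : ℝ) {C₁ C₂ : ℝ}
    (hcov : ∀ (A B : Edge n L → UN N) (x y : Site n L) (i j k l : Fin N) (φ ψ : ℂ → ℝ),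
      (φ = Complex.re ∨ φ = Complex.im) → (ψ = Complex.re ∨ ψ = Complex.im) →
        |cov[fun Q => φ ((Q x : Matrix (Fin N) (Fin N) ℂ) i j),
            fun Q => ψ ((((Q y)⁻¹ : Matrix.specialUnitaryGroup (Fin N) ℂ) :
              Matrix (Fin N) (Fin N) ℂ) k l); slabMeasure N β A B]| ≤ C₁ * Real.exp (-C₂ * torusGraphDist x y))
    (x : Site (n + 1) L) {i j : Fin (n + 1)} (hij : i ≠ j) {R T : ℕ} (hRL : 2 * R ≤ L) (hTL : T ≤ L) :
    |wilsonExpectation (fundamentalRep (Fin N)) ((N : ℝ) * β)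
        (wilsonLoop (fundamentalRep (Fin N)) x i j R T)| ≤
      N * ((N : ℝ) ^ 2 * (4 * C₁ * Real.exp (-C₂ * R))) ^ T := by
  obtain ⟨ī, hī⟩ := Fin.exists_succAbove_eq hij
  set p : Site n L := rem j x + Pi.single ī (R : ZMod L) with hp
  set p' : Site n L := rem j x with hp'
  set A : GaugeConfig (n + 1) L (SU N) → Matrix (Fin N) (Fin N) ℂ :=
    fun U => ((leg i (x i) (rem i x) R U : SU N) : Matrix (Fin N) (Fin N) ℂ) with hA
  set B : GaugeConfig (n + 1) L (SU N) → Matrix (Fin N) (Fin N) ℂ :=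
    fun U => star ((leg i ((x + Pi.single j ((T : ℕ) : ZMod L) : Site (n + 1) L) i)
      (rem i (x + Pi.single j ((T : ℕ) : ZMod L))) R U : SU N) : Matrix (Fin N) (Fin N) ℂ) with hB
  have hdist : torusGraphDist p p' = R := by rw [hp, hp']; exact torusGraphDist_add_single _ ī hRL
  -- the slab two-point bound, for every slab
  set ε : ℝ := 4 * C₁ * Real.exp (-C₂ * R) with hε
  have hεb : ∀ (s : ℕ) (r : {e : Edge (n + 1) L // ¬ IsSlab j (x j + (s : ZMod L)) e} → SU N) (a b c d : Fin N),
      ‖∫ Q, ((Q p : SU N) : Matrix (Fin N) (Fin N) ℂ) a b * (((Q p')⁻¹ : SU N) : Matrix (Fin N) (Fin N) ℂ) c d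
        ∂(slabLaw j (x j + (s : ZMod L)) β r)‖ ≤ ε := by
    intro s r a b c d
    have h := norm_integral_entry_mul_inv_entry_le (n := n) (L := L) hN β
      (topField j (x j + (s : ZMod L)) (glue j (x j + (s : ZMod L)) (fun _ => 1) r))
      (botField j (x j + (s : ZMod L)) (glue j (x j + (s : ZMod L)) (fun _ => 1) r)) (hcov _ _) p p' a b c d
    rw [hdist] at h
    exact h
  have hε0 : 0 ≤ ε := by
    have i0 : Fin N := ⟨0, by omega⟩
    exact (norm_nonneg _).trans (hεb 0 (fun _ => 1) i0 i0 i0 i0)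
  -- the induction, with `K = 1`
  have hmain := norm_integral_loopObs_le (N := N) j (x j) p p' β hε0 hεb T hTL 1 zero_le_one A B
    (fun a b => measurable_coe_leg_entry i _ _ R a b) (fun a b => measurable_star_coe_leg_entry i _ _ R a b)
    (fun U a b => norm_entry_le _ a b) (fun U a b => norm_star_entry_le _ a b)
    (isHorizontal_leg hij _ _ R) (isHorizontal_star_leg hij _ _ R)
  -- the Wilson expectation as a ratio of integrals
  have hW : ∀ U, wilsonLoop (fundamentalRep (Fin N)) x i j R T U =
      (N : ℝ)⁻¹ * (loopObs j (x j) p p' T A B U).re := fun U => wilsonLoop_eq_loopObs x hī R T U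
  set Z := ∫ U, weight N β U ∂(linkMeasure n L N) with hZ
  have hZpos : 0 < Z := integral_exp_neg_mul_wilsonAction_pos (fundamentalRep (Fin N))
    (continuous_fundamentalRep (Fin N)) _
  have hmeas : Measurable (loopObs j (x j) p p' T A B) := by
    have : loopObs j (x j) p p' T A B = fun U => ∑ τ : Fin N × Fin N × Fin N,
        legFactor j (x j) p p' T A τ U * B U τ.2.1 τ.2.2 := funext fun U => loopObs_eq_sum j (x j) p p' T A B U
    rw [this]
    exact Finset.measurable_sum _ fun τ _ => (measurable_legFactor j (x j) p p' T
      (fun a b => measurable_coe_leg_entry i _ _ R a b) τ).mul (measurable_star_coe_leg_entry i _ _ R _ _)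
  have hbd : ∀ U, ‖loopObs j (x j) p p' T A B U‖ ≤ (N : ℝ) ^ 4 := by
    intro U
    rw [loopObs_eq_sum]
    calc _ ≤ ∑ τ : Fin N × Fin N × Fin N, ‖legFactor j (x j) p p' T A τ U * B U τ.2.1 τ.2.2‖ := norm_sum_le _ _
      _ ≤ ∑ _τ : Fin N × Fin N × Fin N, (N : ℝ) * 1 := Finset.sum_le_sum fun τ _ => by
          rw [norm_mul]
          exact mul_le_mul (norm_legFactor_le j (x j) p p' T (fun U a b => norm_entry_le _ a b) τ U)
            (norm_star_entry_le _ _ _) (norm_nonneg _) (Nat.cast_nonneg _)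
      _ = (N : ℝ) ^ 4 := by simp; ring
  have hint : Integrable (fun U => (weight N β U : ℂ) * loopObs j (x j) p p' T A B U) (linkMeasure n L N) :=
    integrable_weight_mul β hmeas hbd
  have hnum : ∫ U, wilsonLoop (fundamentalRep (Fin N)) x i j R T U * weight N β U ∂(linkMeasure n L N) =
      (N : ℝ)⁻¹ * (∫ U, (weight N β U : ℂ) * loopObs j (x j) p p' T A B U ∂(linkMeasure n L N)).re := by
    have h1 := integral_re hint
    simp only [RCLike.re_to_complex, Complex.re_ofReal_mul] at h1
    rw [← h1, ← integral_const_mul]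
    refine integral_congr_ae (ae_of_all _ fun U => ?_)
    simp only [hW]
    ring
  rw [wilsonExpectation_eq_integral_div (fundamentalRep (Fin N)) (continuous_fundamentalRep (Fin N))]
  change |(∫ U, wilsonLoop (fundamentalRep (Fin N)) x i j R T U * weight N β U ∂(linkMeasure n L N)) / Z| ≤ _
  rw [hnum, abs_div, abs_of_pos hZpos, div_le_iff₀ hZpos, abs_mul, abs_inv, Nat.abs_cast]
  have hNr : (0 : ℝ) < N := by exact_mod_cast (show 0 < N by omega)
  calc (N : ℝ)⁻¹ * |(∫ U, (weight N β U : ℂ) * loopObs j (x j) p p' T A B U ∂(linkMeasure n L N)).re|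
      ≤ (N : ℝ)⁻¹ * ‖∫ U, (weight N β U : ℂ) * loopObs j (x j) p p' T A B U ∂(linkMeasure n L N)‖ :=
        mul_le_mul_of_nonneg_left (Complex.abs_re_le_norm _) (inv_nonneg.2 hNr.le)
    _ ≤ (N : ℝ)⁻¹ * ((N : ℝ) ^ 2 * 1 * ((N : ℝ) ^ 2 * ε) ^ T * Z) := mul_le_mul_of_nonneg_left hmain (inv_nonneg.2 hNr.le)
    _ = ((N : ℝ)⁻¹ * N) * N * ((N : ℝ) ^ 2 * ε) ^ T * Z := by ring
    _ = N * ((N : ℝ) ^ 2 * ε) ^ T * Z := by rw [inv_mul_cancel₀ hNr.ne', one_mul]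


/-- Exponent bookkeeping: for `a ≤ K₀`, `1 ≤ K₀` and `R ≥ 2 log K₀ / C₂`,
`(a e^{-C₂R})^T ≤ e^{-(C₂/2) R T}`. [folklore] -/
private theorem pow_mul_exp_le {a K₀ C₂ : ℝ} (ha : 0 ≤ a) (haK : a ≤ K₀) (hK₀ : 1 ≤ K₀) (hC₂ : 0 < C₂) {R : ℕ}
    (hR : 2 * Real.log K₀ / C₂ ≤ R) (T : ℕ) :
    (a * Real.exp (-C₂ * R)) ^ T ≤ Real.exp (-(C₂ / 2) * ((R : ℝ) * T)) := by
  have hK₀pos : 0 < K₀ := lt_of_lt_of_le one_pos hK₀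
  have h1 : (a * Real.exp (-C₂ * R)) ^ T ≤ (K₀ * Real.exp (-C₂ * R)) ^ T :=
    pow_le_pow_left₀ (mul_nonneg ha (Real.exp_pos _).le)
      (mul_le_mul_of_nonneg_right haK (Real.exp_pos _).le) T
  refine h1.trans ?_
  rw [← Real.exp_log hK₀pos, ← Real.exp_add, ← Real.exp_nat_mul]
  refine Real.exp_le_exp.2 ?_
  have h2 : 2 * Real.log K₀ ≤ (R : ℝ) * C₂ := (div_le_iff₀ hC₂).1 hR
  have hT : (0 : ℝ) ≤ T := Nat.cast_nonneg T
  nlinarith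

/-- **Durhuus–Fröhlich / Cao–Nissim–Sheffield Theorem 2.3 holds**: boundary-uniform exponential
clustering of the slab `σ`-models implies Wilson's area law for `SU(N)` lattice Yang–Mills on every
torus, with constants depending only on `(N, d, β)`. Proof: slab disintegration
(`integral_weight_mul_eq`), centre symmetry (`integral_entry_eq_zero`), the induction
`norm_integral_loopObs_le` giving `|⟨W_{R×T}⟩| ≤ N(4N²C₁e^{-C₂R})^T` (`abs_wilsonExpectation_le_pow`),
the same bound with the two directions of the loop exchanged (`wilsonLoop_swap`), and `|⟨W⟩| ≤ 1`
for loops with both sides shorter than `M₀ = 2 log(max(4N²C₁,1))/C₂`. [cite: CaoNissimSheffield2025dynamical, Theorem 2.3] -/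
theorem durhuusFrohlich_areaLaw_of_slabClustering_holds_succ (n : ℕ) {N : ℕ} :
    durhuusFrohlich_areaLaw_of_slabClustering (n + 1) N := by
  intro hd hN β _ hslab
  obtain ⟨C₁, C₂, hC₂, hcov⟩ := hslab
  -- `0 ≤ C₁` (the hypothesis at `L = 1`)
  have i0 : Fin N := ⟨0, by omega⟩
  have hC₁ : 0 ≤ C₁ := by
    have h := hcov 1 (fun _ => 1) (fun _ => 1) (fun _ => 0) (fun _ => 0) i0 i0 i0 i0 Complex.re Complex.re
      (Or.inl rfl) (Or.inl rfl)
    have h' : 0 ≤ C₁ * Real.exp (-C₂ * torusGraphDist (n := n + 1 - 1) (L := 1) (fun _ => 0) (fun _ => 0)) :=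
      (abs_nonneg _).trans h
    exact (mul_nonneg_iff_of_pos_right (Real.exp_pos _)).1 h'
  -- constants
  set K₀ : ℝ := max ((N : ℝ) ^ 2 * (4 * C₁)) 1 with hK₀
  have hK₀1 : 1 ≤ K₀ := le_max_right _ _
  have haK : (N : ℝ) ^ 2 * (4 * C₁) ≤ K₀ := le_max_left _ _
  have ha0 : 0 ≤ (N : ℝ) ^ 2 * (4 * C₁) := by positivity
  set M₀ : ℝ := 2 * Real.log K₀ / C₂ with hM₀
  have hM₀ : 0 ≤ M₀ := div_nonneg (mul_nonneg two_pos.le (Real.log_nonneg hK₀1)) hC₂.le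
  refine ⟨max (N : ℝ) (Real.exp (C₂ / 2 * M₀ ^ 2)), C₂ / 2, half_pos hC₂, ?_⟩
  intro L _ x i j R T hij hR hT hRL hTL
  have hNr : (1 : ℝ) ≤ N := by exact_mod_cast (show 1 ≤ N by omega)
  -- the two oriented bounds
  have hb1 : M₀ ≤ R → |wilsonExpectation (fundamentalRep (Fin N)) ((N : ℝ) * β)
      (wilsonLoop (fundamentalRep (Fin N)) x i j R T)| ≤ N * Real.exp (-(C₂ / 2) * ((R : ℝ) * T)) := by
    intro hMR
    have h := abs_wilsonExpectation_le_pow (n := n) hN β (hcov L) x hij hRL (by omega : T ≤ L)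
    refine h.trans (mul_le_mul_of_nonneg_left ?_ (by positivity))
    have := pow_mul_exp_le ha0 haK hK₀1 hC₂ hMR T
    calc ((N : ℝ) ^ 2 * (4 * C₁ * Real.exp (-C₂ * R))) ^ T
        = ((N : ℝ) ^ 2 * (4 * C₁) * Real.exp (-C₂ * R)) ^ T := by ring
      _ ≤ Real.exp (-(C₂ / 2) * ((R : ℝ) * T)) := this
  have hb2 : M₀ ≤ T → |wilsonExpectation (fundamentalRep (Fin N)) ((N : ℝ) * β)
      (wilsonLoop (fundamentalRep (Fin N)) x i j R T)| ≤ N * Real.exp (-(C₂ / 2) * ((R : ℝ) * T)) := by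
    intro hMT
    have hswap : wilsonLoop (L := L) (fundamentalRep (Fin N)) x i j R T =
        wilsonLoop (fundamentalRep (Fin N)) x j i T R := by
      funext U; exact (wilsonLoop_swap U x i j R T).symm
    rw [hswap]
    have h := abs_wilsonExpectation_le_pow (n := n) hN β (hcov L) x hij.symm hTL (by omega : R ≤ L)
    refine h.trans (mul_le_mul_of_nonneg_left ?_ (by positivity))
    have := pow_mul_exp_le ha0 haK hK₀1 hC₂ hMT R
    calc ((N : ℝ) ^ 2 * (4 * C₁ * Real.exp (-C₂ * T))) ^ R
        = ((N : ℝ) ^ 2 * (4 * C₁) * Real.exp (-C₂ * T)) ^ R := by ring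
      _ ≤ Real.exp (-(C₂ / 2) * ((T : ℝ) * R)) := this
      _ = Real.exp (-(C₂ / 2) * ((R : ℝ) * T)) := by rw [mul_comm (T : ℝ)]
  -- case analysis
  by_cases hMR : M₀ ≤ R
  · exact (hb1 hMR).trans (mul_le_mul_of_nonneg_right (le_max_left _ _) (Real.exp_pos _).le)
  by_cases hMT : M₀ ≤ T
  · exact (hb2 hMT).trans (mul_le_mul_of_nonneg_right (le_max_left _ _) (Real.exp_pos _).le)
  -- both sides short: `|⟨W⟩| ≤ 1 ≤ e^{(C₂/2) M₀²} e^{-(C₂/2) RT}`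
  simp only [not_le] at hMR hMT
  have hRT : (R : ℝ) * T ≤ M₀ ^ 2 := by
    rw [sq]; exact mul_le_mul hMR.le hMT.le (Nat.cast_nonneg T) hM₀
  calc |wilsonExpectation (fundamentalRep (Fin N)) ((N : ℝ) * β) (wilsonLoop (fundamentalRep (Fin N)) x i j R T)|
      ≤ 1 := abs_wilsonExpectation_wilsonLoop_le_one _ x i j R T
    _ ≤ Real.exp (C₂ / 2 * M₀ ^ 2) * Real.exp (-(C₂ / 2) * ((R : ℝ) * T)) := by
        rw [← Real.exp_add]
        exact Real.one_le_exp (by nlinarith)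
    _ ≤ max (N : ℝ) (Real.exp (C₂ / 2 * M₀ ^ 2)) * Real.exp (-(C₂ / 2) * ((R : ℝ) * T)) :=
        mul_le_mul_of_nonneg_right (le_max_right _ _) (Real.exp_pos _).le

end Assembly

end DurhuusFrohlich

variable {d N : ℕ}

/-- **Discharge of the named fact** `durhuusFrohlich_areaLaw_of_slabClustering` (Cao–Nissim–Sheffield
arXiv:2509.04688 Theorem 2.3 = Durhuus–Fröhlich CMP 75 (1980) Thms. 1.2–1.3, case `G = SU(N)`): for
every `d ≥ 2`, `N ≥ 2`, `β ≥ 0`, boundary-uniform slab clustering implies the area law.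
[cite: CaoNissimSheffield2025dynamical, Theorem 2.3] -/
theorem durhuusFrohlich_areaLaw_of_slabClustering_holds : durhuusFrohlich_areaLaw_of_slabClustering d N := by
  intro hd
  obtain ⟨n, rfl⟩ : ∃ n, d = n + 1 := ⟨d - 1, by omega⟩
  exact DurhuusFrohlich.durhuusFrohlich_areaLaw_of_slabClustering_holds_succ n hd

end Literature.MathematicalPhysics.QuantumFieldTheory
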